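import Literature.MathematicalPhysics.QuantumFieldTheory.BalabanImbrieJaffe1984to88.BIJ85NeumannPropagatorRegularDeriv
import Literature.MathematicalPhysics.QuantumFieldTheory.Balaban1983to89.B1Ineq226HolderRegularRegion
import Literature.MathematicalPhysics.QuantumFieldTheory.Balaban1983to89.B3Bound323ZeroTorus


/-!
# `BalabanImbrieJaffe1984to88.BIJ85NeumannPropagatorRegularHolder` — T. Bałaban, J. Imbrie, A. Jaffe, *Renormalization of the Higgs model:
# minimizers, propagators and the stability of mean field theory*, Commun. Math. Phys. **97** (1985) 299–329 [BalabanImbrieJaffe1985], §7.3 p. 326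
# [PDF 28] «The propagators arising from Δ_k(u_k) … also satisfy the regularity and decay estimates of [7]», [7] = T. Bałaban, *Regularity and decay
# of lattice Green's functions*, Commun. Math. Phys. **89** (1983) 571–597 [Balaban1983RegularityDecay] Theorem p. 573 (1.9) and (1.11)–(1.12), [B1] =
# T. Bałaban, *(Higgs)₂,₃ quantum fields in a finite volume. I*, Commun. Math. Phys. **85** (1982) 603–626 [Balaban1982Higgs1] Prop. 2.1 (2.24), (2.26):
# **THE «REGULARITY» HALF — THE HÖLDER MEMBER (1.9)/(2.24) (WITH ITS DECAY FACTOR) AND THE HÖLDER MEMBER OF THE `δG` CLAUSE (1.11)–(1.12)/(2.26)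
# FOR THE REGION NEUMANN PROPAGATORS `G_k(Ω,u)` OF [BalabanImbrieJaffe1988] (2.27)/(5.6.10) (p31's `gBox (α_kL^{kd}) ε⁻¹ u k Ω`) AT `u = e^{ieεA}`
# WITH `A` (2.23)-REGULAR, ALONG ARBITRARY NEAREST-NEIGHBOUR CONTOURS `Γ_{x,x′}` OF LENGTH `≦ d|x − x′|` — PROVED from p35's [B1] Prop. 2.1 Hölder
# members for regions (`B1Ineq224RegularRegion.norm_holder_propagatorK_region_reg_decay_sum`, `B1Ineq226HolderRegularRegion.holder_deltaG_region_reg_decay_sum`)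
# BY NAME through a dictionary for [7]'s transport `U(A(Γ))` (`hol_toE`: p35's `B1TorusChainTransport.hol` acts on `ℝ² ≅ ℂ` as multiplication
# by `holA e A x Γ = e^{ieεA(Γ)}`), the `ε`-scaling at fixed charge (`hol_scaleBy_div`, `covDeriv_scaleBy_div`) and the massive problems
# `m² = t² ↓ 0` of the companion files (same seat: `…RegularDecay` (1.10) value, `…RegularClose` (1.12) value, `…RegularDeriv` derivative members).**

statement-level skeleton of published theorems with citation tags; proofs where landed; nothing here is a claim about the Yang–Mills mass gap

PDFs held: `paper:balaban1985-cmp97-bij-higgs-minimizers` (p. 326 [PDF 28]); `paper:balaban1982-cmp85-higgs23-i` (pp. 604–605, 610–611 [PDF 2–3,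
8–9]); `paper:balaban1983-cmp89-regularity-decay` (pp. 572–573 [PDF 2–3]) — re-read on the materialised pages 2026-08-23.

CITATION HEADER (lean-in-tree rule).  Cell `lit-balaban` (HOME `run/shared/lean/pub/lit-balaban/`), Phase 2, reader seat **r01 gen 26** (unit
`lit-balaban-r01`, literature-prover-lit-balaban-r01-g26-0; B4 fold owner), free-target protocol G.5-34(d), TAKING line HOME/STATUS.md
2026-08-23T01:46Z (file 3 of the generation; files 1–2 = p346673 `…RegularClose`, p347438 `…RegularDeriv`).  Rows served (cells only, no head
change): **B4.Thm@573** (owner r01: the C2-carrier instance of [7]'s Theorem p. 573 at `A ≠ 0`, HÖLDER members of (1.9) and of (1.11)–(1.12),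
REGIONS), **C1.Eq7.3.1-7.3.2** (owner r15: the «regularity» half of the p. 326 sentence for the REGION propagators), **C2.Eq2.30 / C2.Eq2.31**
(owner r18: the Hölder input shapes of the p. 263 sentence «Bounds analogous to (2.30), (2.31) hold for … Hölder derivatives» at a regular non-flat
`u`, print's row-restricted form).  USED BY NAME, never restated: p35's two Hölder region theorems above and `B1TorusChainTransport`
(`TNbr`, `IsTChain`, `bondVal`, `hol`), b04's `B4GaugeCovariance.pathEnd` / `B4Lemma22HolderBox.pathSum`, typer's `HiggsLattice.covDeriv` /
`HiggsCovariance.propagatorK` / `HiggsRescaling`, r18's `BIJ88Sect3Statements.covD`/`cfg`/`toC`, p31's `BIJ88NeumannPropagator227Torus` (`nOp`,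
`gBox`, `proj`, `isUnit_nPad`, `nOp_mul_gBox`, `gBox_mul_proj`), p38's `B5Ineq137Torus.T` with `B3Bound323ZeroTorus.T_eq_supDist`, this seat's
dictionary `BIJ85CovariantHiggsDictionary` (`rotCharge`, `rotCharge_U_toE`, `higgsOf`, `eSite`, `eSite_shift`, `expGauge`, `toC_expGauge`, `vecH`,
`rfield`, `regH`, `propagatorK_rfield_eq`, …), `BIJ85NeumannPropagatorRegularDecay` (`U_scaleBy_div`, `propagatorK_scaleBy_div`,
`isBlockUnion_of_bigBlocks`, `isBigBlockUnion_regH`, `supDist_eSite`, `chi_smul_eq`, `support_of_massive_eq`, `isUnit_nOp_add_mass`) and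
`BIJ85NeumannPropagatorRegularDeriv` (`covDeriv_rfield`, `covDeriv_scaleBy_div`).

WHAT IS PRINTED (verbatim).  [7] p. 572 [PDF 2]: *«… for an arbitrary contour Γ in the lattice we define A(Γ) = Σ_{b⊂Γ} A_b»*; p. 573 [PDF 3]:
*«Finally for an arbitrary pair of points x, x′ ∈ ηZ^d, let us denote by Γ_{x,x′} a shortest contour connecting these points. … Theorem
(Proposition 2.1 of [1]). For α < 1 there exist positive constants δ₀, c₀, R₀ independent of A, k, Ω and depending on d, M only, c₀ on α also,
such that for e sufficiently small and for an arbitrary function f: Ω → R^N, we have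
1/|x − x′|^α |U(A(Γ_{x,x′}))(D^η_{A,μ}G_k(Ω, A)f)(x′) − (D^η_{A,μ}G_k(Ω, A)f)(x)| ≦ c₀exp(−δ₀ dist({x, x′}, supp f))‖f‖_∞ (1.9) for x, x′ ∈ Ω,
and satisfying the condition dist({x, x′}, Ω^c) ≧ R₀. … If Ω ⊂ Ω₀, then for δG_k(Ω, Ω₀, A) … we have the inequalities … (with the same
restrictions on x, x′) with the additional factor (1.12) on the right hand sides.»*  [B1] p. 610–611 [PDF 8–9]: (2.24) = (1.9) and «(2.24), (2.25)
with the additional factor exp(−δ₀ dist(supp f, Ω^c) − δ₀ dist({x, x′}, Ω^c)) … Ω^c means a complement in T_η».  [BIJ88] p. 263: *«Bounds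
analogous to (2.30), (2.31) hold for covariant derivatives and Hölder derivatives of G_{k,loc}(u) of order less than two.»*  The printed
`|x − x′|^{−α}` (η-units) is `((|x − x′|_∞/L^k)⁻¹)^α` in fine-lattice steps (p35's reading, kept); the contour `Γ_{x,x′}` enters as ANY
nearest-neighbour chain of length `≦ d·|x − x′|_∞` (p35's `B1TorusChainTransport`: covers every shortest contour).

WHAT THIS FILE PROVES (kernel-checked, 0 `sorry`; four small definitions with bodies, theorems otherwise; no `Prop` fact).
* §1 THE CONTOUR VOCABULARY ON THE `Setup` TORUS AND ITS DICTIONARY: `SNbr`/`IsSChain` (nearest-neighbour chains; twins of p35's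
  `TNbr`/`IsTChain`), `bondSum` (the pair form «A_{b̄} = −A_b»), **`holA e A x Γ = e^{ieεA(Γ)}`** ([7]'s `U(A(Γ))` for the character `U(A) = e^{ieηA}`;
  `holA_cons`: the ordered product of the link variables `u_b = e^{ieεA_b}` of `expGauge e A`, `holA_single_of_bondSum`, `norm_holA = 1`);
  `sNbr_eSite_iff`, `isSChain_map_iff`, `pathEnd_map`, `pathSum_map`, `bondVal_vecH`, `pathSum_bondVal_vecH`, **`hol_toE`** (p35's
  `hol (rotCharge e) A_H y Γ_H (toE z) = toE (holA e A (e y) (e Γ_H) · z)`), **`hol_scaleBy_div`** (`U_{tε}((t⁻¹A)(Γ)) = U_ε(A(Γ))`).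
* §2 the massive problems (`m² = t² ∈ (0,1]`, uniform): **`holder_massive_solution_le`** ((2.24) for the `Ω`-supported solution of
  `(nOp_Ω + t²)ψ = h`: `((|x−x′|/L^k)⁻¹)^α·‖U(A(Γ))(D_uψ)(x′,μ) − (D_uψ)(x,μ)‖ ≦ c₀(L^kε)e^{−D/(4L^sL^k)}M`) and **`holder_massive_diff_le`** (the
  (2.26) Hölder member for `ψ − ψ₀`, factor `e^{−(D+D₀+D₁)/(8L^sL^k)}`) — p35's inner statements as hypotheses `hB1h`, `hB2h`, on the `tε`-torus:
  `(U(A(Γ))(D_uψ)(x′) − (D_uψ)(x))_ℝ = t⁻¹·(U_{tε}((t⁻¹A)(Γ))D^{tε}Φ(x′) − D^{tε}Φ(x))`, `Φ = G^{tε}_k(Ω_H,t⁻¹A_H;1)h_ℝ`, and p35's `c₀(tL^kε)`.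
* §3 **`holder_covD_gBox_le`** — [7] (1.9) = [B1] (2.24), REGION PROPAGATORS AT `u = e^{ieεA}`: `∃ s₀, ∀ α ∈ [0,1), ∀ s ≧ s₀, ∃ c₀ e₁ > 0`: on every
  `Setup` torus, `1 ≦ k ≦ K`, `k + s ≦ m + K`, `3L^kL^s ≦ 2L^{m+K}`, `Ω` a union of big blocks (`L^k·L^s` sites), `A` (2.23)-regular on `Ω` (`0 < e_k ≦
  e₁`), sites `x ≠ x′` with `{|y − x| ≦ R₀′}`, `{|y − x′| ≦ R₀′} ⊂ Ω` (`R₀′ = 2rS + 2L^kL^s(d+1) + 1`), a nearest-neighbour contour `Γ` from `x` to `x′`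
  of length `≦ d|x − x′|_∞`, `f` with `|f| ≦ M` vanishing on `{|z − x| < D} ∪ {|z − x′| < D}`, every `μ`:
  `((|x−x′|_∞/L^k)⁻¹)^α·‖U(A(Γ))·ε⁻¹(u(G f)(x′+e_μ) − (G f)(x′)) − ε⁻¹(u(G f)(x+e_μ) − (G f)(x))‖ ≦ c₀(L^kε)·e^{−D/(4L^sL^k)}·M`, `G = gBox … k Ω`, the
  covariant derivative = r18's `covD P.eps⁻¹ (cfg u)`; resolvent identity, §2 for both terms, `t ↓ 0`.  **`holder_covD_gBox_univ_le`** — `Ω = T^{(0)}`.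
* §4 **`holder_covD_gBox_sub_gBox_le`** — the Hölder member of the `δG` clause for `Ω ⊆ Ω₀` big-block unions, `A` regular on `Ω₀`, `f` supported
  in `Ω`, `D₀ ≦ dist({x,x′},T∖Ω)`, `D₁ ≦ dist(supp f,T∖Ω)`: the same Hölder quotient of `D_u(G_k(Ω,u)f − G_k(Ω₀,u)f)` is
  `≦ c₀(L^kε)·e^{−(D+D₀+D₁)/(8L^sL^k)}·M`.  **`holder_covD_gBox_sub_gBox_univ_le`** — `Ω₀ = T^{(0)}`.
* §5 **`input19_holder_regular_deep`** — the (1.9) input shape of p29's `BIJ88LocDerivHolder230FlatTorus.holder19_flat_cube_level` at a regular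
  `u = e^{ieεA}` (level-`k` units, p38's metric `T`): `(L^k/T(x₁,x₂))^α·‖holA·(D_uG f)(x₂,μ) − (D_uG f)(x₁,μ)‖ ≦ s_k·(c₀·e^{−δ₀·((L^k)⁻¹D)}·F)`,
  `δ₀ = 1/(4L^s)`, the flat transport `h(x₁)h(x₂)⁻¹` replaced by `U(A(Γ))` for a contour `Γ` of length `≦ d·T(x₁,x₂)` (print's row restriction).
HONEST SCOPE.  (i) Hölder members of (1.9)/(2.24) and of (2.26) in the print's `D^η_{A,μ}` form, `0 ≦ α < 1` (the referee ruling G-ref1-32 on the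
printed «α < 0»); the transport along a CHOSEN contour (any nearest-neighbour chain of length `≦ d|x − x′|_∞`; the print's «a shortest contour»
is one of them); the value/derivative members are the companion files'.  (ii) `u` EXACTLY `e^{ieεA}`, `A` regular on `Ω` (resp. `Ω₀`); no gauge
change performed.  (iii) Constants p35's (`M = K₀ = L^s`; `c₀` depends on `α`, as printed «c₀ on α also»; rates `1/(4L^s)`, `1/(8L^s)` per
`L^kε`; prefactor one power of `L^kε`).  (iv) `N = 2`; rows `x, x′` both `R₀′`-deep in `Ω`; distances to `T∖Ω`.  (v) Not a restatement: no Hölder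
bound for `gBox` at a non-flat field existed in the tree (flat: p31 `holder19_flat_cube`, p29's level-`k` forms).
Unit `lit-balaban-r01` gen 26 (literature-prover-lit-balaban-r01-g26-0), 2026-08-23.  NOT summit progress.
-/

namespace Literature.MathematicalPhysics.QuantumFieldTheory.BalabanImbrieJaffe1984to88.BIJ85NeumannPropagatorRegularHolder

open Literature.MathematicalPhysics.QuantumFieldTheory.Balaban1983to89
open HiggsLattice (ChargeData)
open HiggsCovariance (propagatorK)
open HiggsRescaling (mesh_scaleBy)
open BIJ85CovariantHiggsDictionary
open BIJ85NeumannPropagatorRegularDecay (U_scaleBy_div propagatorK_scaleBy_div isBlockUnion_of_bigBlocks isBigBlockUnion_regH supDist_eSite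
  chi_smul_eq support_of_massive_eq isUnit_nOp_add_mass)
open BIJ85NeumannPropagatorRegularDeriv (covDeriv_scaleBy_div covDeriv_rfield)
open BIJ88Sect3Statements (U1 toC cfg covD)
open BIJ88NeumannPropagator227Torus (nOp nPad gBox proj proj_mulVec nOp_mul_gBox isUnit_nPad)
open BIJ88NeumannNoZeroModesTorus (IsBlockUnion)
open B1TorusChainTransport (TNbr IsTChain bondVal hol)
open B4GaugeCovariance (pathEnd)
open B4Lemma22HolderBox (pathSum)
open scoped BigOperators Matrix
open Finset Matrix

noncomputable section

/-! ## §1 Contours and the `U(1)` transport on the `Setup` torus; the dictionary -/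

section Contours

variable {P : Params}

/-- Lattice neighbours on the fine `Setup` torus `T^{(0)}`: `y = x + e_μ` or `x = y + e_μ` (the bonds `⟨x, y⟩` in either orientation; the
twin of p35's `B1TorusChainTransport.TNbr`). [cite: Balaban1983RegularityDecay, p.572 «an arbitrary contour Γ in the lattice»] -/
def SNbr (x y : Balaban1983to89.Site P 0) : Prop := ∃ μ : Fin P.d, y = x.shift μ ∨ x = y.shift μ

/-- A CONTOUR on the `Setup` torus «considered as a sum of bonds»: the chain `x, l₀, …, l_{n−1}`, consecutive sites lattice neighbours (end
point `pathEnd x l`, length `l.length`; the twin of p35's `IsTChain`). [cite: Balaban1983RegularityDecay, p.572 «an arbitrary contour Γ in the lattice»] -/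
def IsSChain : Balaban1983to89.Site P 0 → List (Balaban1983to89.Site P 0) → Prop
  | _, [] => True
  | x, y :: l => SNbr x y ∧ IsSChain y l

/-- THE PAIR FORM OF A REAL BOND FIELD on the `Setup` torus: `A(u,v) = A_b` if `(u,v) = (b₋,b₊)`, `−A_b` if `(u,v) = (b₊,b₋)`, `0` otherwise
(the twin of p35's `bondVal`; «A_{b̄} = −A_b»). [cite: Balaban1983RegularityDecay, p.572 «A(Γ) = Σ_{b⊂Γ} A_b», p.576 «A_{b̄} = −A_b»] -/
def bondSum (A : PBond P 0 → ℝ) (u v : Balaban1983to89.Site P 0) : ℝ :=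
  ∑ μ : Fin P.d, ((if v = u.shift μ then A ⟨u, μ⟩ else 0) - (if u = v.shift μ then A ⟨v, μ⟩ else 0))

/-- **THE `U(1)` TRANSPORT `U(A(Γ)) = e^{ieεA(Γ)}` ALONG A CONTOUR `Γ = (x, l)` OF THE FINE `Setup` TORUS**, `A(Γ) = Σ_{b⊂Γ} A_b` (the lineage's
`pathSum` of the pair form) — the link variables `u_b = e^{ieεA_b}` of `expGauge e A` multiplied along `Γ` (`holA_cons`), i.e. [7]'s
`U(A(Γ_{x,x′}))` of (1.9) for the one-parameter group `U(A) = e^{ieηA}` on `ℂ`. [cite: Balaban1983RegularityDecay, (1.4) p.572, (1.9) p.573] -/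
def holA (e : ℝ) (A : PBond P 0 → ℝ) (x : Balaban1983to89.Site P 0) (l : List (Balaban1983to89.Site P 0)) : ℂ :=
  Complex.exp (((P.eps * e * pathSum (bondSum A) x l : ℝ) : ℂ) * Complex.I)

/-- `U(A(∅)) = 1`. [cite: Balaban1983RegularityDecay, (1.4) p.572] -/
theorem holA_nil (e : ℝ) (A : PBond P 0 → ℝ) (x : Balaban1983to89.Site P 0) : holA e A x [] = 1 := by
  simp [holA, pathSum]

/-- `U(A(Γ))` is the ordered product of the link variables: `U(A(x, y :: l)) = e^{ieεA(x,y)}·U(A(y, l))`.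
[cite: Balaban1983RegularityDecay, (1.4) p.572] -/
theorem holA_cons (e : ℝ) (A : PBond P 0 → ℝ) (x y : Balaban1983to89.Site P 0) (l : List (Balaban1983to89.Site P 0)) :
    holA e A x (y :: l) = Complex.exp (((P.eps * e * bondSum A x y : ℝ) : ℂ) * Complex.I) * holA e A y l := by
  simp only [holA, pathSum, ← Complex.exp_add]
  congr 1
  push_cast
  ring

/-- On a forward bond the transport is the link variable `u_b = e^{ieεA_b}` of `expGauge e A` — when `bondSum A x (x+e_μ) = A_{⟨x,μ⟩}`, which
holds on every torus with more than two sites per direction (p35's `bondVal_shift`); stated with that value as a hypothesis.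
[cite: Balaban1983RegularityDecay, (1.4) p.572] -/
theorem holA_single_of_bondSum (e : ℝ) (A : PBond P 0 → ℝ) (x y : Balaban1983to89.Site P 0) (μ : Fin P.d)
    (h : bondSum A x y = A ⟨x, μ⟩) : holA e A x [y] = toC (expGauge P e A ⟨x, μ⟩) := by
  rw [holA_cons, holA_nil, mul_one, h, toC_expGauge]

/-- `|U(A(Γ))| = 1`. [cite: Balaban1983RegularityDecay, (1.4) p.572] -/
theorem norm_holA (e : ℝ) (A : PBond P 0 → ℝ) (x : Balaban1983to89.Site P 0) (l : List (Balaban1983to89.Site P 0)) :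
    ‖holA e A x l‖ = 1 := by
  rw [holA, Complex.norm_exp_ofReal_mul_I]

variable {s : ℕ}

/-- kernel: neighbours correspond under the site dictionary `e`. [cite: Balaban1982Higgs1, (1.2) p.604, dictionary] -/
theorem sNbr_eSite_iff (hs : 0 + s ≤ P.m + P.K) (y y' : HiggsLattice.Site (higgsOf P s) 0) :
    SNbr (eSite P s rfl hs y) (eSite P s rfl hs y') ↔ TNbr y y' := by
  unfold SNbr TNbr
  refine exists_congr fun μ => ?_
  rw [← eSite_shift, ← eSite_shift, (eSite P s rfl hs).injective.eq_iff, (eSite P s rfl hs).injective.eq_iff]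

/-- kernel: chains correspond under the site dictionary. [cite: Balaban1982Higgs1, (1.2) p.604, dictionary] -/
theorem isSChain_map_iff (hs : 0 + s ≤ P.m + P.K) :
    ∀ (y : HiggsLattice.Site (higgsOf P s) 0) (l : List (HiggsLattice.Site (higgsOf P s) 0)),
      IsSChain (eSite P s rfl hs y) (l.map (eSite P s rfl hs)) ↔ IsTChain y l
  | _, [] => by simp [IsSChain, IsTChain]
  | y, y' :: l => by
    simp only [List.map_cons, IsSChain, IsTChain]
    rw [sNbr_eSite_iff, isSChain_map_iff hs y' l]

/-- kernel: end points correspond under the site dictionary. [folklore] -/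
private theorem pathEnd_map {X Y : Type*} (φ : X → Y) : ∀ (x : X) (l : List X), pathEnd (φ x) (l.map φ) = φ (pathEnd x l)
  | _, [] => rfl
  | _, y :: l => by simp only [List.map_cons, pathEnd]; exact pathEnd_map φ y l

/-- kernel: `pathSum` along a mapped chain. [folklore] -/
private theorem pathSum_map {X Y : Type*} (φ : X → Y) (B : Y → Y → ℝ) :
    ∀ (x : X) (l : List X), pathSum B (φ x) (l.map φ) = pathSum (fun u v => B (φ u) (φ v)) x l
  | _, [] => rfl
  | x, y :: l => by simp only [List.map_cons, pathSum]; rw [pathSum_map φ B y l]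

/-- kernel: the pair form of `A_H` is the pair form of `A` read through the dictionary. [cite: Balaban1983RegularityDecay, p.572 «A(Γ) = Σ_{b⊂Γ} A_b», dictionary] -/
theorem bondVal_vecH (hs : 0 + s ≤ P.m + P.K) (A : PBond P 0 → ℝ) (y y' : HiggsLattice.Site (higgsOf P s) 0) :
    bondVal (vecH P s hs A) y y' = bondSum A (eSite P s rfl hs y) (eSite P s rfl hs y') := by
  unfold bondVal bondSum
  refine Finset.sum_congr rfl fun μ _ => ?_
  have e1 : (eSite P s rfl hs y' = (eSite P s rfl hs y).shift μ) ↔ (y' = y.shift μ) := by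
    rw [← eSite_shift, (eSite P s rfl hs).injective.eq_iff]
  have e2 : (eSite P s rfl hs y = (eSite P s rfl hs y').shift μ) ↔ (y = y'.shift μ) := by
    rw [← eSite_shift, (eSite P s rfl hs).injective.eq_iff]
  rw [vecH_apply, vecH_apply]
  simp only [e1, e2]

/-- kernel: `A_H(Γ_H) = A(Γ)` for corresponding chains. [cite: Balaban1983RegularityDecay, p.572 «A(Γ) = Σ_{b⊂Γ} A_b», dictionary] -/
theorem pathSum_bondVal_vecH (hs : 0 + s ≤ P.m + P.K) (A : PBond P 0 → ℝ) (y : HiggsLattice.Site (higgsOf P s) 0)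
    (l : List (HiggsLattice.Site (higgsOf P s) 0)) :
    pathSum (bondVal (vecH P s hs A)) y l = pathSum (bondSum A) (eSite P s rfl hs y) (l.map (eSite P s rfl hs)) := by
  rw [pathSum_map]
  congr 1
  funext u v
  exact bondVal_vecH hs A u v

/-- **[7]'s TRANSPORT `U(A(Γ))` ON THE REALIFIED FIELD IS MULTIPLICATION BY `e^{ieεA(Γ)}`**: p35's `hol (rotCharge e) A_H y Γ_H` acts on
`ℝ² ≅ ℂ` as multiplication by `holA e A (e y) (e Γ_H)` (`rotCharge_U_toE`; `A_H(Γ_H) = A(Γ)`).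
[cite: Balaban1983RegularityDecay, (1.4) p.572, (1.9) p.573, dictionary] [cite: Balaban1982Higgs1, (1.7) p.605] -/
theorem hol_toE (hs : 0 + s ≤ P.m + P.K) (e : ℝ) (A : PBond P 0 → ℝ) (y : HiggsLattice.Site (higgsOf P s) 0)
    (l : List (HiggsLattice.Site (higgsOf P s) 0)) (z : ℂ) :
    hol (rotCharge e) (vecH P s hs A) y l (toE z) = toE (holA e A (eSite P s rfl hs y) (l.map (eSite P s rfl hs)) * z) := by
  unfold hol holA
  rw [rotCharge_U_toE, higgsOf_mesh_zero, pathSum_bondVal_vecH]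

variable {Q : HiggsLattice.Params} {N : ℕ} {t : ℝ}

/-- kernel: the pair form is linear in the field. [folklore] -/
private theorem bondVal_div (ht : 0 < t) (A : HiggsLattice.VecField Q 0) (u v : HiggsLattice.Site Q 0) :
    bondVal (P := Q.scaleBy t ht) (fun b => t⁻¹ * A ⟨b.src, b.dir⟩) u v = t⁻¹ * bondVal (P := Q) A u v := by
  unfold bondVal
  rw [Finset.mul_sum]
  refine Finset.sum_congr rfl fun μ _ => ?_
  show (if v = u.shift μ then t⁻¹ * A ⟨u, μ⟩ else 0) - (if u = v.shift μ then t⁻¹ * A ⟨v, μ⟩ else 0)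
    = t⁻¹ * ((if v = u.shift μ then A ⟨u, μ⟩ else 0) - (if u = v.shift μ then A ⟨v, μ⟩ else 0))
  split_ifs <;> ring

/-- kernel: `(t⁻¹A)(Γ) = t⁻¹A(Γ)` on the `tε`-lattice (labels). [folklore] -/
private theorem pathSum_bondVal_div (ht : 0 < t) (A : HiggsLattice.VecField Q 0) :
    ∀ (u : HiggsLattice.Site Q 0) (l : List (HiggsLattice.Site Q 0)),
      pathSum (bondVal (P := Q.scaleBy t ht) (fun b => t⁻¹ * A ⟨b.src, b.dir⟩)) u l = t⁻¹ * pathSum (bondVal (P := Q) A) u l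
  | _, [] => by simp [pathSum]
  | u, v :: l => by
    show bondVal (P := Q.scaleBy t ht) (fun b => t⁻¹ * A ⟨b.src, b.dir⟩) u v
        + pathSum (bondVal (P := Q.scaleBy t ht) (fun b => t⁻¹ * A ⟨b.src, b.dir⟩)) v l
      = t⁻¹ * (bondVal (P := Q) A u v + pathSum (bondVal (P := Q) A) v l)
    rw [bondVal_div ht, pathSum_bondVal_div ht A v l, mul_add]

/-- **THE TRANSPORT IS SCALE-FREE AT FIXED CHARGE**: `U_{tε}((t⁻¹A)(Γ)) = U_ε(A(Γ))` ([B1] (1.22): the combinatorial torus and its contours are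
labels; `U_scaleBy_div`). [cite: Balaban1982Higgs1, (1.22) p.607] -/
theorem hol_scaleBy_div (ht : 0 < t) (C : ChargeData N) (A : HiggsLattice.VecField Q 0) (u : HiggsLattice.Site Q 0)
    (l : List (HiggsLattice.Site Q 0)) :
    hol (P := Q.scaleBy t ht) C (fun b => t⁻¹ * A ⟨b.src, b.dir⟩) u l = hol (P := Q) C A u l := by
  unfold hol
  rw [pathSum_bondVal_div ht, U_scaleBy_div]

end Contours

/-! ## §2 The Hölder members of [B1] (2.24)/(2.26) at (2.23)-regular `A`, transferred to the massive `Setup` problems, `m² = t² ∈ (0,1]` -/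

section Massive

variable {P : Params} {s : ℕ}

/-- kernel: the chain read back on the Higgs torus maps onto the given chain. [folklore] -/
private theorem map_symm_map (hs : 0 + s ≤ P.m + P.K) (l : List (Balaban1983to89.Site P 0)) :
    (l.map (eSite P s rfl hs).symm).map (eSite P s rfl hs) = l := by
  rw [List.map_map]
  conv_rhs => rw [← List.map_id l]
  exact List.map_congr_left fun x _ => Equiv.apply_symm_apply _ x

/-- kernel: nearest-neighbour chains do not see the `ε`-scaling (the combinatorial torus is unchanged). [folklore] -/
private theorem isTChain_scaleBy_iff {Q : HiggsLattice.Params} {t : ℝ} (ht : 0 < t) :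
    ∀ (u : HiggsLattice.Site Q 0) (l : List (HiggsLattice.Site Q 0)), IsTChain (P := Q.scaleBy t ht) u l ↔ IsTChain (P := Q) u l
  | _, [] => by simp only [IsTChain]
  | u, v :: l => by
    simp only [IsTChain]
    rw [isTChain_scaleBy_iff ht v l]
    exact Iff.rfl

/-- kernel (the Higgs-side form of the companion file's identity): for an `X`-supported solution of `(nOp_X + t²)ψ = h`, the covariant derivative
of `ψ_ℝ` is `t⁻¹` times p35's covariant derivative, on the `tε`-torus with the divided field, of `G^{tε}_k(X_H, t⁻¹A_H; 1)h_ℝ`.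
[cite: Balaban1982Higgs1, (2.22) p.610, dictionary] -/
private theorem covDeriv_massive_eq (hs : 0 + s ≤ P.m + P.K) {k : ℕ} (hk1 : 1 ≤ k) (hks : k + s ≤ P.m + P.K) (e : ℝ)
    (A : PBond P 0 → ℝ) {a : ℝ} (ha : 0 < a) {X : Finset (Balaban1983to89.Site P 0)} (hX : IsBlockUnion k X) {t : ℝ} (ht : 0 < t)
    {ψ h : Balaban1983to89.Site P 0 → ℂ} (hψ : ∀ z, z ∉ X → ψ z = 0)
    (heq : nOp (B1RG242Torus.α P a k * (P.L : ℝ) ^ (k * P.d)) P.eps⁻¹ (expGauge P e A) k X *ᵥ ψ + ((t ^ 2 : ℝ) : ℂ) • ψ = h)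
    (y : HiggsLattice.Site (higgsOf P s) 0) (μ : Fin P.d) :
    HiggsLattice.covDeriv (rotCharge e) (vecH P s hs A) (rfield P s hs ψ) ⟨y, μ⟩
      = t⁻¹ • HiggsLattice.covDeriv (P := (higgsOf P s).scaleBy t ht) (rotCharge e) (fun b => t⁻¹ * vecH P s hs A ⟨b.src, b.dir⟩)
          (propagatorK (P := (higgsOf P s).scaleBy t ht) (rotCharge e) (regH P s hs X)
            (fun b => t⁻¹ * vecH P s hs A ⟨b.src, b.dir⟩) 1 a k (rfield P s hs h)) ⟨y, μ⟩ := by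
  have hak : 0 ≤ B1.aSeq a (P.L : ℝ) k := (B1.aSeq_pos ha (B1RG242Torus.one_lt_cast_L P) hk1).le
  have hcol := propagatorK_rfield_eq hs hks e A (pow_pos ht 2) hak hX hψ heq
  have hsc := propagatorK_scaleBy_div (Q := higgsOf P s) ht (rotCharge e) (regH P s hs X) (vecH P s hs A) a k hak (rfield P s hs h)
  have h1 : ∀ y, rfield P s hs ψ y = t⁻¹ ^ 2 • (propagatorK (P := (higgsOf P s).scaleBy t ht) (rotCharge e) (regH P s hs X)
      (fun b => t⁻¹ * vecH P s hs A ⟨b.src, b.dir⟩) 1 a k (rfield P s hs h)) y := by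
    intro y
    have e1 := congrFun hcol y
    have e2 := congrFun hsc y
    rw [← e1]
    show _ = t⁻¹ ^ 2 • (propagatorK (P := (higgsOf P s).scaleBy t ht) (rotCharge e) (regH P s hs X)
      (fun b => t⁻¹ * vecH P s hs A ⟨b.src, b.dir⟩) 1 a k (rfield P s hs h)) y
    rw [e2]
    show _ = t⁻¹ ^ 2 • (t ^ 2 • (propagatorK (rotCharge e) (regH P s hs X) (vecH P s hs A) (t ^ 2) a k) (rfield P s hs h) y)
    rw [smul_smul, show t⁻¹ ^ 2 * t ^ 2 = 1 by field_simp, one_smul]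
  unfold HiggsLattice.covDeriv
  show ((higgsOf P s).mesh 0)⁻¹ • ((rotCharge e).U ((higgsOf P s).mesh 0) (vecH P s hs A ⟨y, μ⟩)
        (rfield P s hs ψ (y.shift μ)) - rfield P s hs ψ y)
    = t⁻¹ • ((((higgsOf P s).scaleBy t ht).mesh 0)⁻¹ • ((rotCharge e).U (((higgsOf P s).scaleBy t ht).mesh 0)
        (t⁻¹ * vecH P s hs A ⟨y, μ⟩)
        (propagatorK (P := (higgsOf P s).scaleBy t ht) (rotCharge e) (regH P s hs X)
          (fun b => t⁻¹ * vecH P s hs A ⟨b.src, b.dir⟩) 1 a k (rfield P s hs h) (y.shift μ))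
      - propagatorK (P := (higgsOf P s).scaleBy t ht) (rotCharge e) (regH P s hs X)
          (fun b => t⁻¹ * vecH P s hs A ⟨b.src, b.dir⟩) 1 a k (rfield P s hs h) y))
  rw [h1 (y.shift μ), h1 y, U_scaleBy_div, mesh_scaleBy, map_smul, ← smul_sub, smul_smul, smul_smul, mul_inv]
  congr 1
  ring

/-- kernel: the Hölder expression of the massive solution, realified, is `t⁻¹` times p35's Hölder expression on the `tε`-torus.
[cite: Balaban1983RegularityDecay, (1.9) p.573, dictionary] -/
private theorem holder_massive_eq (hs : 0 + s ≤ P.m + P.K) {k : ℕ} (hk1 : 1 ≤ k) (hks : k + s ≤ P.m + P.K) (e : ℝ)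
    (A : PBond P 0 → ℝ) {a : ℝ} (ha : 0 < a) {X : Finset (Balaban1983to89.Site P 0)} (hX : IsBlockUnion k X) {t : ℝ} (ht : 0 < t)
    {ψ h : Balaban1983to89.Site P 0 → ℂ} (hψ : ∀ z, z ∉ X → ψ z = 0)
    (heq : nOp (B1RG242Torus.α P a k * (P.L : ℝ) ^ (k * P.d)) P.eps⁻¹ (expGauge P e A) k X *ᵥ ψ + ((t ^ 2 : ℝ) : ℂ) • ψ = h)
    (yH y'H : HiggsLattice.Site (higgsOf P s) 0) (lH : List (HiggsLattice.Site (higgsOf P s) 0)) (μ : Fin P.d) :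
    toE (holA e A (eSite P s rfl hs yH) (lH.map (eSite P s rfl hs)) * covD P.eps⁻¹ (cfg (expGauge P e A)) ψ ⟨eSite P s rfl hs y'H, μ⟩
        - covD P.eps⁻¹ (cfg (expGauge P e A)) ψ ⟨eSite P s rfl hs yH, μ⟩)
      = t⁻¹ • (hol (P := (higgsOf P s).scaleBy t ht) (rotCharge e) (fun b => t⁻¹ * vecH P s hs A ⟨b.src, b.dir⟩) yH lH
            (HiggsLattice.covDeriv (P := (higgsOf P s).scaleBy t ht) (rotCharge e) (fun b => t⁻¹ * vecH P s hs A ⟨b.src, b.dir⟩)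
              (propagatorK (P := (higgsOf P s).scaleBy t ht) (rotCharge e) (regH P s hs X)
                (fun b => t⁻¹ * vecH P s hs A ⟨b.src, b.dir⟩) 1 a k (rfield P s hs h)) ⟨y'H, μ⟩)
          - HiggsLattice.covDeriv (P := (higgsOf P s).scaleBy t ht) (rotCharge e) (fun b => t⁻¹ * vecH P s hs A ⟨b.src, b.dir⟩)
              (propagatorK (P := (higgsOf P s).scaleBy t ht) (rotCharge e) (regH P s hs X)
                (fun b => t⁻¹ * vecH P s hs A ⟨b.src, b.dir⟩) 1 a k (rfield P s hs h)) ⟨yH, μ⟩) := by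
  rw [map_sub, ← hol_toE, ← covDeriv_rfield hs e A ψ y'H μ, ← covDeriv_rfield hs e A ψ yH μ,
    covDeriv_massive_eq hs hk1 hks e A ha hX ht hψ heq y'H μ, covDeriv_massive_eq hs hk1 hks e A ha hX ht hψ heq yH μ, map_smul,
    ← smul_sub, ← hol_scaleBy_div (Q := higgsOf P s) ht (rotCharge e) (vecH P s hs A) yH lH]

/-- **THE HÖLDER QUOTIENT OF THE MASSIVE SOLUTIONS, UNIFORMLY IN `m² = t² ∈ (0,1]`** ([B1] (2.24)): if p35's
`B1Ineq224RegularRegion.norm_holder_propagatorK_region_reg_decay_sum` inner statement holds with the constants `(L^s, c₀, e₁)` at `m² = 1`, the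
exponent `α`, mesh cap `1` (hypothesis `hB1h`), then on a `Setup` torus (`L`, `d`), for a big-block union `Ω` (blocks `L^k·L^s`), `A` regular on `Ω`
(`0 < e_k ≦ e₁`), sites `x ≠ x′` with `{|y − x| ≦ R₀′}`, `{|y − x′| ≦ R₀′} ⊂ Ω`, a nearest-neighbour chain `Γ = (x, l)` ending at `x′` of length
`≦ d|x − x′|_∞`, an `Ω`-supported solution of `(nOp_Ω + t²)ψ = h` (`h` supported in `Ω`, `|h| ≦ M`, `h = 0` within `D` of `x` and of `x′`), and
every `μ`:  `((|x−x′|_∞/L^k)⁻¹)^α·‖U(A(Γ))·ε⁻¹(uψ(x′+e_μ) − ψ(x′)) − ε⁻¹(uψ(x+e_μ) − ψ(x))‖ ≦ c₀(L^kε)·e^{−D/(4L^sL^k)}·M`.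
[cite: Balaban1982Higgs1, Prop. 2.1 (2.24) p.610] [cite: Balaban1983RegularityDecay, Theorem p.573 (1.9)] -/
theorem holder_massive_solution_le (d L s : ℕ) {a : ℝ} (ha : 0 < a) (e creg β : ℝ) {α : ℝ} (c₀ e₁ : ℝ)
    (hB1h : ∀ (P' : HiggsLattice.Params), P'.d = d → P'.L = L → L ^ s ∣ P'.M →
      ∀ {K : ℕ}, 1 ≤ K → K ≤ P'.K → (∀ μ, 3 * B1TorusCubeCover.half P' K (L ^ s) ≤ P'.sitesPerDir 0 μ) → P'.mesh K ≤ 1 →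
      ∀ (Ω' : Finset (HiggsLattice.Site P' 0)), B1TorusRegionHSizes.IsBigBlockUnion K (L ^ s) Ω' →
      ∀ (A' : HiggsLattice.VecField P' 0) {ec : ℝ}, 0 < ec → ec ≤ e₁ →
      (∀ z ∈ Ω', ∀ μ ν : Fin P'.d,
          P'.mesh K * |(rotCharge e).e| / ec * |A' ⟨z.shift μ, ν⟩ - A' ⟨z, ν⟩| ≤ creg * ec ^ (β - 1) / (P'.L : ℝ) ^ K) →
      ∀ (μ : Fin P'.d) (x x' : HiggsLattice.Site P' 0), x' ≠ x →
        (∀ y, HiggsLattice.Site.tdist x y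
            ≤ 2 * B1TorusCubeLocality26.rS P' K (L ^ s) + 2 * B1TorusCubeCover.half P' K (L ^ s) * (P'.d + 1) + 1 → y ∈ Ω') →
        (∀ y, HiggsLattice.Site.tdist x' y
            ≤ 2 * B1TorusCubeLocality26.rS P' K (L ^ s) + 2 * B1TorusCubeCover.half P' K (L ^ s) * (P'.d + 1) + 1 → y ∈ Ω') →
        ∀ (l : List (HiggsLattice.Site P' 0)), IsTChain x l → pathEnd x l = x' →
          (l.length : ℝ) ≤ (P'.d : ℝ) * HiggsLattice.Site.tdist x x' →
        ∀ (g : HiggsLattice.ScalarField P' 0 2) (M D : ℝ), (∀ y, ‖g y‖ ≤ M) → 0 ≤ D →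
          (∀ z, g z ≠ 0 → D ≤ (HiggsLattice.Site.tdist x z : ℝ)) → (∀ z, g z ≠ 0 → D ≤ (HiggsLattice.Site.tdist x' z : ℝ)) →
            (((HiggsLattice.Site.tdist x x' : ℝ) / (P'.L : ℝ) ^ K)⁻¹) ^ α *
                ‖hol (rotCharge e) A' x l (HiggsLattice.covDeriv (rotCharge e) A'
                    (propagatorK (rotCharge e) Ω' A' 1 a K (B1TorusRegionRop.chi Ω' • g)) ⟨x', μ⟩)
                  - HiggsLattice.covDeriv (rotCharge e) A' (propagatorK (rotCharge e) Ω' A' 1 a K (B1TorusRegionRop.chi Ω' • g)) ⟨x, μ⟩‖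
              ≤ c₀ * P'.mesh K * Real.exp (-(D / (4 * (L ^ s : ℕ) * (P'.L : ℝ) ^ K))) * M)
    (P : Params) (hPd : P.d = d) (hPL : P.L = L) (hs : 0 + s ≤ P.m + P.K) {k : ℕ} (hk1 : 1 ≤ k) (hkK : k ≤ P.K)
    (hks : k + s ≤ P.m + P.K) (hsize : 3 * (L ^ k * L ^ s) ≤ P.sitesPerDir 0)
    {Ω : Finset (Balaban1983to89.Site P 0)}
    (hbig : ∀ z z' : Balaban1983to89.Site P 0,
      (∀ μ, (z μ).val / (L ^ k * L ^ s) = (z' μ).val / (L ^ k * L ^ s)) → (z ∈ Ω ↔ z' ∈ Ω))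
    (A : PBond P 0 → ℝ) {ec : ℝ} (hec : 0 < ec) (hece : ec ≤ e₁)
    (hreg : ∀ z ∈ Ω, ∀ μ ν : Fin P.d,
      P.spacing k * |e| / ec * |A ⟨z.shift μ, ν⟩ - A ⟨z, ν⟩| ≤ creg * ec ^ (β - 1) / (L : ℝ) ^ k)
    (μ : Fin P.d) (x x' : Balaban1983to89.Site P 0) (hne : x' ≠ x)
    (hint : ∀ y, LatticeFieldCalculus.supDist x y
      ≤ 2 * (5 * (L ^ k * L ^ s) / 8 + L ^ k) + 2 * (L ^ k * L ^ s) * (d + 1) + 1 → y ∈ Ω)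
    (hint' : ∀ y, LatticeFieldCalculus.supDist x' y
      ≤ 2 * (5 * (L ^ k * L ^ s) / 8 + L ^ k) + 2 * (L ^ k * L ^ s) * (d + 1) + 1 → y ∈ Ω)
    (l : List (Balaban1983to89.Site P 0)) (hch : IsSChain x l) (hend : pathEnd x l = x')
    (hlen : (l.length : ℝ) ≤ (d : ℝ) * LatticeFieldCalculus.supDist x x')
    {t : ℝ} (ht : 0 < t) (ht1 : t ≤ 1) {ψ h : Balaban1983to89.Site P 0 → ℂ} (hψ : ∀ z, z ∉ Ω → ψ z = 0)
    (hh : ∀ z, z ∉ Ω → h z = 0)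
    (heq : nOp (B1RG242Torus.α P a k * (P.L : ℝ) ^ (k * P.d)) P.eps⁻¹ (expGauge P e A) k Ω *ᵥ ψ + ((t ^ 2 : ℝ) : ℂ) • ψ = h)
    (M D : ℝ) (hM : ∀ z, ‖h z‖ ≤ M) (hD : 0 ≤ D) (hsupp : ∀ z, h z ≠ 0 → D ≤ (LatticeFieldCalculus.supDist x z : ℝ))
    (hsupp' : ∀ z, h z ≠ 0 → D ≤ (LatticeFieldCalculus.supDist x' z : ℝ)) :
    (((LatticeFieldCalculus.supDist x x' : ℝ) / (L : ℝ) ^ k)⁻¹) ^ α *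
        ‖holA e A x l * covD P.eps⁻¹ (cfg (expGauge P e A)) ψ ⟨x', μ⟩ - covD P.eps⁻¹ (cfg (expGauge P e A)) ψ ⟨x, μ⟩‖
      ≤ c₀ * P.spacing k * Real.exp (-(D / (4 * (L : ℝ) ^ s * (L : ℝ) ^ k))) * M := by
  subst hPd hPL
  have hΩ : IsBlockUnion k Ω := isBlockUnion_of_bigBlocks (s := s) (by omega) hbig
  -- the sites and the chain read on the Higgs torus
  obtain ⟨xH, rfl⟩ : ∃ xH, eSite P s rfl hs xH = x := ⟨(eSite P s rfl hs).symm x, Equiv.apply_symm_apply _ _⟩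
  obtain ⟨x'H, rfl⟩ : ∃ x'H, eSite P s rfl hs x'H = x' := ⟨(eSite P s rfl hs).symm x', Equiv.apply_symm_apply _ _⟩
  set lH := l.map (eSite P s rfl hs).symm with hlH_def
  have hlH : lH.map (eSite P s rfl hs) = l := map_symm_map hs l
  have hneH : x'H ≠ xH := fun h0 => hne (by rw [h0])
  have hchH : IsTChain (P := (higgsOf P s).scaleBy t ht) xH lH :=
    (isTChain_scaleBy_iff ht xH lH).2 ((isSChain_map_iff hs xH lH).1 (by rw [hlH]; exact hch))
  have hendH : pathEnd xH lH = x'H :=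
    (eSite P s rfl hs).injective (by rw [← pathEnd_map (eSite P s rfl hs) xH lH, hlH, hend])
  have hlenH : (lH.length : ℝ) ≤ (((higgsOf P s).scaleBy t ht).d : ℝ)
      * (HiggsLattice.Site.tdist (P := (higgsOf P s).scaleBy t ht) xH x'H : ℝ) := by
    show (lH.length : ℝ) ≤ (P.d : ℝ) * (HiggsLattice.Site.tdist (P := higgsOf P s) xH x'H : ℝ)
    rw [hlH_def, List.length_map, ← supDist_eSite hs]
    exact hlen
  -- [B1] (2.24) on the `tε`-torus
  have hb := hB1h ((higgsOf P s).scaleBy t ht) rfl rfl (dvd_refl _) hk1 (show k ≤ P.m + P.K - s by omega)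
    (fun μ => by
      rw [show ((higgsOf P s).scaleBy t ht).sitesPerDir 0 μ = P.sitesPerDir 0 from higgsOf_sitesPerDir hs μ]
      exact hsize)
    (by
      rw [mesh_scaleBy, higgsOf_mesh]
      refine mul_le_one₀ ht1 (P.spacing_pos k).le ?_
      rw [← P.spacing_K]
      exact mul_le_mul_of_nonneg_right (pow_le_pow_right₀ (B1RG242Torus.one_lt_cast_L P).le hkK) P.eps_pos.le)
    (regH P s hs Ω) (isBigBlockUnion_regH hs hbig ht) (fun b => t⁻¹ * vecH P s hs A ⟨b.src, b.dir⟩) hec hece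
    (fun z hz μ ν => by
      have hz' : eSite P s rfl hs z ∈ Ω := (mem_regH hs Ω z).1 hz
      rw [mesh_scaleBy, higgsOf_mesh, rotCharge_e]
      show t * P.spacing k * |e| / ec * |t⁻¹ * vecH P s hs A ⟨HiggsLattice.Site.shift (P := higgsOf P s) z μ, ν⟩
          - t⁻¹ * vecH P s hs A ⟨z, ν⟩| ≤ creg * ec ^ (β - 1) / (P.L : ℝ) ^ k
      rw [vecH_apply, vecH_apply, eSite_shift, ← mul_sub, abs_mul, abs_of_pos (inv_pos.2 ht),
        show t * P.spacing k * |e| / ec * (t⁻¹ * |A ⟨(eSite P s rfl hs z).shift μ, ν⟩ - A ⟨eSite P s rfl hs z, ν⟩|)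
          = P.spacing k * |e| / ec * |A ⟨(eSite P s rfl hs z).shift μ, ν⟩ - A ⟨eSite P s rfl hs z, ν⟩| by
            field_simp]
      exact hreg _ hz' μ ν)
    μ xH x'H hneH
    (fun y hy => (mem_regH hs Ω y).2 (hint _ (by
      rw [supDist_eSite]
      exact hy)))
    (fun y hy => (mem_regH hs Ω y).2 (hint' _ (by
      rw [supDist_eSite]
      exact hy)))
    lH hchH hendH hlenH
    (rfield P s hs h) M D (fun y => by rw [norm_rfield_apply]; exact hM _) hD
    (fun z hz => by
      have hz' : h (eSite P s rfl hs z) ≠ 0 := fun h0 => hz (by rw [rfield_apply, h0, map_zero])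
      have := hsupp _ hz'
      rw [supDist_eSite] at this
      exact this)
    (fun z hz => by
      have hz' : h (eSite P s rfl hs z) ≠ 0 := fun h0 => hz (by rw [rfield_apply, h0, map_zero])
      have := hsupp' _ hz'
      rw [supDist_eSite] at this
      exact this)
  -- assemble
  have hchi := chi_smul_eq hs hh ht (Ω := Ω) (rfield P s hs h) fun _ => rfl
  rw [hchi] at hb
  have hb' : (((HiggsLattice.Site.tdist xH x'H : ℝ) / (((higgsOf P s).scaleBy t ht).L : ℝ) ^ k)⁻¹) ^ α *
      ‖hol (P := (higgsOf P s).scaleBy t ht) (rotCharge e) (fun b => t⁻¹ * vecH P s hs A ⟨b.src, b.dir⟩) xH lH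
          (HiggsLattice.covDeriv (P := (higgsOf P s).scaleBy t ht) (rotCharge e) (fun b => t⁻¹ * vecH P s hs A ⟨b.src, b.dir⟩)
            (propagatorK (P := (higgsOf P s).scaleBy t ht) (rotCharge e) (regH P s hs Ω)
              (fun b => t⁻¹ * vecH P s hs A ⟨b.src, b.dir⟩) 1 a k (rfield P s hs h)) ⟨x'H, μ⟩)
        - HiggsLattice.covDeriv (P := (higgsOf P s).scaleBy t ht) (rotCharge e) (fun b => t⁻¹ * vecH P s hs A ⟨b.src, b.dir⟩)
            (propagatorK (P := (higgsOf P s).scaleBy t ht) (rotCharge e) (regH P s hs Ω)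
              (fun b => t⁻¹ * vecH P s hs A ⟨b.src, b.dir⟩) 1 a k (rfield P s hs h)) ⟨xH, μ⟩‖
        ≤ c₀ * ((higgsOf P s).scaleBy t ht).mesh k
          * Real.exp (-(D / (4 * (P.L ^ s : ℕ) * (((higgsOf P s).scaleBy t ht).L : ℝ) ^ k))) * M := hb
  rw [mesh_scaleBy, higgsOf_mesh, Nat.cast_pow, show (((higgsOf P s).scaleBy t ht).L : ℝ) = P.L from rfl, ← supDist_eSite hs] at hb'
  rw [← LinearIsometryEquiv.norm_map toE, ← hlH, holder_massive_eq hs hk1 hks e A ha hΩ ht hψ heq xH x'H lH μ, norm_smul,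
    Real.norm_of_nonneg (inv_pos.2 ht).le]
  calc _ = t⁻¹ * ((((LatticeFieldCalculus.supDist (eSite P s rfl hs xH) (eSite P s rfl hs x'H) : ℝ) / (P.L : ℝ) ^ k)⁻¹) ^ α * ‖_‖) := by
        ring
    _ ≤ t⁻¹ * (c₀ * (t * P.spacing k) * Real.exp (-(D / (4 * (P.L : ℝ) ^ s * (P.L : ℝ) ^ k))) * M) :=
        mul_le_mul_of_nonneg_left hb' (inv_pos.2 ht).le
    _ = _ := by field_simp

/-- **THE HÖLDER QUOTIENT OF THE DIFFERENCE OF THE MASSIVE SOLUTIONS ON `Ω ⊆ Ω₀`, UNIFORMLY IN `m² = t² ∈ (0,1]`** ([B1] (2.26), Hölder member):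
with p35's `B1Ineq226HolderRegularRegion.holder_deltaG_region_reg_decay_sum` inner statement as the hypothesis `hB2h` (constants `(L^s, c₀, e₁)`,
exponent `α`, `m² = 1`, mesh cap `1`) and the data of `holder_massive_solution_le` on the pair `Ω ⊆ Ω₀` (`A` regular on `Ω₀`, `h` supported in
`Ω`, `D₀ ≦ dist({x,x′},T∖Ω)`, `D₁ ≦ dist(supp h,T∖Ω)`, solutions `ψ`, `ψ₀` on `Ω`, `Ω₀`):  the Hölder quotient of
`U(A(Γ))(D_u(ψ−ψ₀))(x′,μ) − (D_u(ψ−ψ₀))(x,μ)` is `≦ c₀(L^kε)·e^{−(D+D₀+D₁)/(8L^sL^k)}·M`. [cite: Balaban1982Higgs1, Prop. 2.1 (2.26) pp.610–611] -/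
theorem holder_massive_diff_le (d L s : ℕ) {a : ℝ} (ha : 0 < a) (e creg β : ℝ) {α : ℝ} (c₀ e₁ : ℝ)
    (hB2h : ∀ (P' : HiggsLattice.Params), P'.d = d → P'.L = L → L ^ s ∣ P'.M →
      ∀ {K : ℕ}, 1 ≤ K → K ≤ P'.K → (∀ μ, 3 * B1TorusCubeCover.half P' K (L ^ s) ≤ P'.sitesPerDir 0 μ) → P'.mesh K ≤ 1 →
      ∀ (Ω' Ω₀' : Finset (HiggsLattice.Site P' 0)), B1TorusRegionHSizes.IsBigBlockUnion K (L ^ s) Ω' →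
        B1TorusRegionHSizes.IsBigBlockUnion K (L ^ s) Ω₀' → Ω' ⊆ Ω₀' →
      ∀ (A' : HiggsLattice.VecField P' 0) {ec : ℝ}, 0 < ec → ec ≤ e₁ →
      (∀ z ∈ Ω₀', ∀ μ ν : Fin P'.d,
          P'.mesh K * |(rotCharge e).e| / ec * |A' ⟨z.shift μ, ν⟩ - A' ⟨z, ν⟩| ≤ creg * ec ^ (β - 1) / (P'.L : ℝ) ^ K) →
      ∀ (μ : Fin P'.d) (x x' : HiggsLattice.Site P' 0), x' ≠ x →
        (∀ y, HiggsLattice.Site.tdist x y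
            ≤ 2 * B1TorusCubeLocality26.rS P' K (L ^ s) + 2 * B1TorusCubeCover.half P' K (L ^ s) * (P'.d + 1) + 1 → y ∈ Ω') →
        (∀ y, HiggsLattice.Site.tdist x' y
            ≤ 2 * B1TorusCubeLocality26.rS P' K (L ^ s) + 2 * B1TorusCubeCover.half P' K (L ^ s) * (P'.d + 1) + 1 → y ∈ Ω') →
        ∀ (l : List (HiggsLattice.Site P' 0)), IsTChain x l → pathEnd x l = x' →
          (l.length : ℝ) ≤ (P'.d : ℝ) * HiggsLattice.Site.tdist x x' →
        ∀ (g : HiggsLattice.ScalarField P' 0 2) (M D D₀ D₁ : ℝ), (∀ y, ‖g y‖ ≤ M) → 0 ≤ D → 0 ≤ D₀ → 0 ≤ D₁ →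
          (∀ z, g z ≠ 0 → D ≤ (HiggsLattice.Site.tdist x z : ℝ)) → (∀ z, g z ≠ 0 → D ≤ (HiggsLattice.Site.tdist x' z : ℝ)) →
          (∀ z, z ∉ Ω' → D₀ ≤ (HiggsLattice.Site.tdist x z : ℝ)) → (∀ z, z ∉ Ω' → D₀ ≤ (HiggsLattice.Site.tdist x' z : ℝ)) →
          (∀ y z, g y ≠ 0 → z ∉ Ω' → D₁ ≤ (HiggsLattice.Site.tdist z y : ℝ)) →
            (((HiggsLattice.Site.tdist x x' : ℝ) / (P'.L : ℝ) ^ K)⁻¹) ^ α *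
                ‖hol (rotCharge e) A' x l (HiggsLattice.covDeriv (rotCharge e) A'
                    (propagatorK (rotCharge e) Ω' A' 1 a K (B1TorusRegionRop.chi Ω' • g)
                      - propagatorK (rotCharge e) Ω₀' A' 1 a K (B1TorusRegionRop.chi Ω₀' • g)) ⟨x', μ⟩)
                  - HiggsLattice.covDeriv (rotCharge e) A' (propagatorK (rotCharge e) Ω' A' 1 a K (B1TorusRegionRop.chi Ω' • g)
                      - propagatorK (rotCharge e) Ω₀' A' 1 a K (B1TorusRegionRop.chi Ω₀' • g)) ⟨x, μ⟩‖
              ≤ c₀ * P'.mesh K * Real.exp (-((D + D₀ + D₁) / (8 * (L ^ s : ℕ) * (P'.L : ℝ) ^ K))) * M)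
    (P : Params) (hPd : P.d = d) (hPL : P.L = L) (hs : 0 + s ≤ P.m + P.K) {k : ℕ} (hk1 : 1 ≤ k) (hkK : k ≤ P.K)
    (hks : k + s ≤ P.m + P.K) (hsize : 3 * (L ^ k * L ^ s) ≤ P.sitesPerDir 0)
    {Ω Ω₀ : Finset (Balaban1983to89.Site P 0)}
    (hbig : ∀ z z' : Balaban1983to89.Site P 0,
      (∀ μ, (z μ).val / (L ^ k * L ^ s) = (z' μ).val / (L ^ k * L ^ s)) → (z ∈ Ω ↔ z' ∈ Ω))
    (hbig₀ : ∀ z z' : Balaban1983to89.Site P 0,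
      (∀ μ, (z μ).val / (L ^ k * L ^ s) = (z' μ).val / (L ^ k * L ^ s)) → (z ∈ Ω₀ ↔ z' ∈ Ω₀))
    (hsub : Ω ⊆ Ω₀)
    (A : PBond P 0 → ℝ) {ec : ℝ} (hec : 0 < ec) (hece : ec ≤ e₁)
    (hreg : ∀ z ∈ Ω₀, ∀ μ ν : Fin P.d,
      P.spacing k * |e| / ec * |A ⟨z.shift μ, ν⟩ - A ⟨z, ν⟩| ≤ creg * ec ^ (β - 1) / (L : ℝ) ^ k)
    (μ : Fin P.d) (x x' : Balaban1983to89.Site P 0) (hne : x' ≠ x)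
    (hint : ∀ y, LatticeFieldCalculus.supDist x y
      ≤ 2 * (5 * (L ^ k * L ^ s) / 8 + L ^ k) + 2 * (L ^ k * L ^ s) * (d + 1) + 1 → y ∈ Ω)
    (hint' : ∀ y, LatticeFieldCalculus.supDist x' y
      ≤ 2 * (5 * (L ^ k * L ^ s) / 8 + L ^ k) + 2 * (L ^ k * L ^ s) * (d + 1) + 1 → y ∈ Ω)
    (l : List (Balaban1983to89.Site P 0)) (hch : IsSChain x l) (hend : pathEnd x l = x')
    (hlen : (l.length : ℝ) ≤ (d : ℝ) * LatticeFieldCalculus.supDist x x')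
    {t : ℝ} (ht : 0 < t) (ht1 : t ≤ 1) {ψ ψ₀ h : Balaban1983to89.Site P 0 → ℂ} (hψ : ∀ z, z ∉ Ω → ψ z = 0)
    (hψ₀ : ∀ z, z ∉ Ω₀ → ψ₀ z = 0) (hh : ∀ z, z ∉ Ω → h z = 0)
    (heq : nOp (B1RG242Torus.α P a k * (P.L : ℝ) ^ (k * P.d)) P.eps⁻¹ (expGauge P e A) k Ω *ᵥ ψ + ((t ^ 2 : ℝ) : ℂ) • ψ = h)
    (heq₀ : nOp (B1RG242Torus.α P a k * (P.L : ℝ) ^ (k * P.d)) P.eps⁻¹ (expGauge P e A) k Ω₀ *ᵥ ψ₀ + ((t ^ 2 : ℝ) : ℂ) • ψ₀ = h)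
    (M D D₀ D₁ : ℝ) (hM : ∀ z, ‖h z‖ ≤ M) (hD : 0 ≤ D) (hD₀ : 0 ≤ D₀) (hD₁ : 0 ≤ D₁)
    (hsupp : ∀ z, h z ≠ 0 → D ≤ (LatticeFieldCalculus.supDist x z : ℝ))
    (hsupp' : ∀ z, h z ≠ 0 → D ≤ (LatticeFieldCalculus.supDist x' z : ℝ))
    (hxD₀ : ∀ z, z ∉ Ω → D₀ ≤ (LatticeFieldCalculus.supDist x z : ℝ))
    (hxD₀' : ∀ z, z ∉ Ω → D₀ ≤ (LatticeFieldCalculus.supDist x' z : ℝ))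
    (hhD₁ : ∀ y z, h y ≠ 0 → z ∉ Ω → D₁ ≤ (LatticeFieldCalculus.supDist z y : ℝ)) :
    (((LatticeFieldCalculus.supDist x x' : ℝ) / (L : ℝ) ^ k)⁻¹) ^ α *
        ‖holA e A x l * covD P.eps⁻¹ (cfg (expGauge P e A)) (ψ - ψ₀) ⟨x', μ⟩ - covD P.eps⁻¹ (cfg (expGauge P e A)) (ψ - ψ₀) ⟨x, μ⟩‖
      ≤ c₀ * P.spacing k * Real.exp (-((D + D₀ + D₁) / (8 * (L : ℝ) ^ s * (L : ℝ) ^ k))) * M := by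
  subst hPd hPL
  have hΩ : IsBlockUnion k Ω := isBlockUnion_of_bigBlocks (s := s) (by omega) hbig
  have hΩ₀ : IsBlockUnion k Ω₀ := isBlockUnion_of_bigBlocks (s := s) (by omega) hbig₀
  have hh₀ : ∀ z, z ∉ Ω₀ → h z = 0 := fun z hz => hh z fun hz' => hz (hsub hz')
  have hsubH : regH P s hs Ω ⊆ regH P s hs Ω₀ := fun y hy =>
    (mem_regH hs Ω₀ y).2 (hsub ((mem_regH hs Ω y).1 hy))
  obtain ⟨xH, rfl⟩ : ∃ xH, eSite P s rfl hs xH = x := ⟨(eSite P s rfl hs).symm x, Equiv.apply_symm_apply _ _⟩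
  obtain ⟨x'H, rfl⟩ : ∃ x'H, eSite P s rfl hs x'H = x' := ⟨(eSite P s rfl hs).symm x', Equiv.apply_symm_apply _ _⟩
  set lH := l.map (eSite P s rfl hs).symm with hlH_def
  have hlH : lH.map (eSite P s rfl hs) = l := map_symm_map hs l
  have hneH : x'H ≠ xH := fun h0 => hne (by rw [h0])
  have hchH : IsTChain (P := (higgsOf P s).scaleBy t ht) xH lH :=
    (isTChain_scaleBy_iff ht xH lH).2 ((isSChain_map_iff hs xH lH).1 (by rw [hlH]; exact hch))
  have hendH : pathEnd xH lH = x'H :=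
    (eSite P s rfl hs).injective (by rw [← pathEnd_map (eSite P s rfl hs) xH lH, hlH, hend])
  have hlenH : (lH.length : ℝ) ≤ (((higgsOf P s).scaleBy t ht).d : ℝ)
      * (HiggsLattice.Site.tdist (P := (higgsOf P s).scaleBy t ht) xH x'H : ℝ) := by
    show (lH.length : ℝ) ≤ (P.d : ℝ) * (HiggsLattice.Site.tdist (P := higgsOf P s) xH x'H : ℝ)
    rw [hlH_def, List.length_map, ← supDist_eSite hs]
    exact hlen
  -- [B1] (2.26), Hölder member, on the `tε`-torus
  have hb := hB2h ((higgsOf P s).scaleBy t ht) rfl rfl (dvd_refl _) hk1 (show k ≤ P.m + P.K - s by omega)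
    (fun μ => by
      rw [show ((higgsOf P s).scaleBy t ht).sitesPerDir 0 μ = P.sitesPerDir 0 from higgsOf_sitesPerDir hs μ]
      exact hsize)
    (by
      rw [mesh_scaleBy, higgsOf_mesh]
      refine mul_le_one₀ ht1 (P.spacing_pos k).le ?_
      rw [← P.spacing_K]
      exact mul_le_mul_of_nonneg_right (pow_le_pow_right₀ (B1RG242Torus.one_lt_cast_L P).le hkK) P.eps_pos.le)
    (regH P s hs Ω) (regH P s hs Ω₀) (isBigBlockUnion_regH hs hbig ht) (isBigBlockUnion_regH hs hbig₀ ht) hsubH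
    (fun b => t⁻¹ * vecH P s hs A ⟨b.src, b.dir⟩) hec hece
    (fun z hz μ ν => by
      have hz' : eSite P s rfl hs z ∈ Ω₀ := (mem_regH hs Ω₀ z).1 hz
      rw [mesh_scaleBy, higgsOf_mesh, rotCharge_e]
      show t * P.spacing k * |e| / ec * |t⁻¹ * vecH P s hs A ⟨HiggsLattice.Site.shift (P := higgsOf P s) z μ, ν⟩
          - t⁻¹ * vecH P s hs A ⟨z, ν⟩| ≤ creg * ec ^ (β - 1) / (P.L : ℝ) ^ k
      rw [vecH_apply, vecH_apply, eSite_shift, ← mul_sub, abs_mul, abs_of_pos (inv_pos.2 ht),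
        show t * P.spacing k * |e| / ec * (t⁻¹ * |A ⟨(eSite P s rfl hs z).shift μ, ν⟩ - A ⟨eSite P s rfl hs z, ν⟩|)
          = P.spacing k * |e| / ec * |A ⟨(eSite P s rfl hs z).shift μ, ν⟩ - A ⟨eSite P s rfl hs z, ν⟩| by
            field_simp]
      exact hreg _ hz' μ ν)
    μ xH x'H hneH
    (fun y hy => (mem_regH hs Ω y).2 (hint _ (by
      rw [supDist_eSite]
      exact hy)))
    (fun y hy => (mem_regH hs Ω y).2 (hint' _ (by
      rw [supDist_eSite]
      exact hy)))
    lH hchH hendH hlenH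
    (rfield P s hs h) M D D₀ D₁ (fun y => by rw [norm_rfield_apply]; exact hM _) hD hD₀ hD₁
    (fun z hz => by
      have hz' : h (eSite P s rfl hs z) ≠ 0 := fun h0 => hz (by rw [rfield_apply, h0, map_zero])
      have := hsupp _ hz'
      rw [supDist_eSite] at this
      exact this)
    (fun z hz => by
      have hz' : h (eSite P s rfl hs z) ≠ 0 := fun h0 => hz (by rw [rfield_apply, h0, map_zero])
      have := hsupp' _ hz'
      rw [supDist_eSite] at this
      exact this)
    (fun z hz => by
      have hz' : eSite P s rfl hs z ∉ Ω := fun h' => hz ((mem_regH hs Ω z).2 h')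
      have := hxD₀ _ hz'
      rw [supDist_eSite] at this
      exact this)
    (fun z hz => by
      have hz' : eSite P s rfl hs z ∉ Ω := fun h' => hz ((mem_regH hs Ω z).2 h')
      have := hxD₀' _ hz'
      rw [supDist_eSite] at this
      exact this)
    (fun y z hy hz => by
      have hy' : h (eSite P s rfl hs y) ≠ 0 := fun h0 => hy (by rw [rfield_apply, h0, map_zero])
      have hz' : eSite P s rfl hs z ∉ Ω := fun h' => hz ((mem_regH hs Ω z).2 h')
      have := hhD₁ _ _ hy' hz'
      rw [supDist_eSite] at this
      exact this)
  -- assemble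
  have hchi := chi_smul_eq hs hh ht (Ω := Ω) (rfield P s hs h) fun _ => rfl
  have hchi₀ := chi_smul_eq hs hh₀ ht (Ω := Ω₀) (rfield P s hs h) fun _ => rfl
  rw [hchi, hchi₀] at hb
  -- abbreviations for the two scaled propagator columns
  set Φ := propagatorK (P := (higgsOf P s).scaleBy t ht) (rotCharge e) (regH P s hs Ω)
      (fun b => t⁻¹ * vecH P s hs A ⟨b.src, b.dir⟩) 1 a k (rfield P s hs h) with hΦ
  set Φ₀ := propagatorK (P := (higgsOf P s).scaleBy t ht) (rotCharge e) (regH P s hs Ω₀)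
      (fun b => t⁻¹ * vecH P s hs A ⟨b.src, b.dir⟩) 1 a k (rfield P s hs h) with hΦ₀
  have hb' : (((HiggsLattice.Site.tdist xH x'H : ℝ) / (((higgsOf P s).scaleBy t ht).L : ℝ) ^ k)⁻¹) ^ α *
      ‖hol (P := (higgsOf P s).scaleBy t ht) (rotCharge e) (fun b => t⁻¹ * vecH P s hs A ⟨b.src, b.dir⟩) xH lH
          (HiggsLattice.covDeriv (P := (higgsOf P s).scaleBy t ht) (rotCharge e) (fun b => t⁻¹ * vecH P s hs A ⟨b.src, b.dir⟩)
            (Φ - Φ₀) ⟨x'H, μ⟩)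
        - HiggsLattice.covDeriv (P := (higgsOf P s).scaleBy t ht) (rotCharge e) (fun b => t⁻¹ * vecH P s hs A ⟨b.src, b.dir⟩)
            (Φ - Φ₀) ⟨xH, μ⟩‖
        ≤ c₀ * ((higgsOf P s).scaleBy t ht).mesh k
          * Real.exp (-((D + D₀ + D₁) / (8 * (P.L ^ s : ℕ) * (((higgsOf P s).scaleBy t ht).L : ℝ) ^ k))) * M := hb
  rw [mesh_scaleBy, higgsOf_mesh, Nat.cast_pow, show (((higgsOf P s).scaleBy t ht).L : ℝ) = P.L from rfl, ← supDist_eSite hs] at hb'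
  -- the Hölder expressions are linear in the field: difference of the two identities of `holder_massive_eq`
  have hlinD : ∀ (y : HiggsLattice.Site (higgsOf P s) 0),
      HiggsLattice.covDeriv (P := (higgsOf P s).scaleBy t ht) (rotCharge e) (fun b => t⁻¹ * vecH P s hs A ⟨b.src, b.dir⟩)
          (Φ - Φ₀) ⟨y, μ⟩
        = HiggsLattice.covDeriv (P := (higgsOf P s).scaleBy t ht) (rotCharge e) (fun b => t⁻¹ * vecH P s hs A ⟨b.src, b.dir⟩) Φ ⟨y, μ⟩
          - HiggsLattice.covDeriv (P := (higgsOf P s).scaleBy t ht) (rotCharge e) (fun b => t⁻¹ * vecH P s hs A ⟨b.src, b.dir⟩)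
            Φ₀ ⟨y, μ⟩ := by
    intro y
    unfold HiggsLattice.covDeriv
    rw [Pi.sub_apply, Pi.sub_apply, map_sub, ← smul_sub]
    congr 1
    abel
  have hcovD : ∀ (b : PBond P 0), covD P.eps⁻¹ (cfg (expGauge P e A)) (ψ - ψ₀) b
      = covD P.eps⁻¹ (cfg (expGauge P e A)) ψ b - covD P.eps⁻¹ (cfg (expGauge P e A)) ψ₀ b := by
    intro b
    simp only [covD, Pi.sub_apply]
    ring
  have hE : holA e A (eSite P s rfl hs xH) l * covD P.eps⁻¹ (cfg (expGauge P e A)) (ψ - ψ₀) ⟨eSite P s rfl hs x'H, μ⟩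
        - covD P.eps⁻¹ (cfg (expGauge P e A)) (ψ - ψ₀) ⟨eSite P s rfl hs xH, μ⟩
      = (holA e A (eSite P s rfl hs xH) (lH.map (eSite P s rfl hs)) * covD P.eps⁻¹ (cfg (expGauge P e A)) ψ ⟨eSite P s rfl hs x'H, μ⟩
          - covD P.eps⁻¹ (cfg (expGauge P e A)) ψ ⟨eSite P s rfl hs xH, μ⟩)
        - (holA e A (eSite P s rfl hs xH) (lH.map (eSite P s rfl hs)) * covD P.eps⁻¹ (cfg (expGauge P e A)) ψ₀ ⟨eSite P s rfl hs x'H, μ⟩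
          - covD P.eps⁻¹ (cfg (expGauge P e A)) ψ₀ ⟨eSite P s rfl hs xH, μ⟩) := by
    rw [hlH, hcovD, hcovD]
    ring
  have hsplit : ∀ (a₁ a₂ b₁ b₂ : EuclideanSpace ℝ (Fin 2)), a₁ - b₁ - (a₂ - b₂) = (a₁ - a₂) - (b₁ - b₂) := fun _ _ _ _ => by abel
  rw [← LinearIsometryEquiv.norm_map toE, hE, map_sub, holder_massive_eq hs hk1 hks e A ha hΩ ht hψ heq xH x'H lH μ,
    holder_massive_eq hs hk1 hks e A ha hΩ₀ ht hψ₀ heq₀ xH x'H lH μ, ← smul_sub, norm_smul, Real.norm_of_nonneg (inv_pos.2 ht).le,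
    ← hΦ, ← hΦ₀, hsplit, ← map_sub, ← hlinD x'H, ← hlinD xH]
  calc _ = t⁻¹ * ((((LatticeFieldCalculus.supDist (eSite P s rfl hs xH) (eSite P s rfl hs x'H) : ℝ) / (P.L : ℝ) ^ k)⁻¹) ^ α * ‖_‖) := by
        ring
    _ ≤ t⁻¹ * (c₀ * (t * P.spacing k) * Real.exp (-((D + D₀ + D₁) / (8 * (P.L : ℝ) ^ s * (P.L : ℝ) ^ k))) * M) :=
        mul_le_mul_of_nonneg_left hb' (inv_pos.2 ht).le
    _ = _ := by field_simp

end Massive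

/-! ## §3 [BIJ85] p.326 / [7] (1.9): the Hölder member for the region Neumann propagators at `u = e^{ieεA}`, `A` regular -/

section Holder

variable {P : Params}

/-- kernel: the Hölder expression `U(A(Γ))·(D_uφ)(x′,μ) − (D_uφ)(x,μ)` is additive in the field. [folklore] -/
private theorem holderExpr_add (w : ℂ) (c : ℝ) (u : PBond P 0 → ℂ) (φ ψ : Balaban1983to89.Site P 0 → ℂ) (b b' : PBond P 0) :
    w * covD c u (φ + ψ) b' - covD c u (φ + ψ) b = (w * covD c u φ b' - covD c u φ b) + (w * covD c u ψ b' - covD c u ψ b) := by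
  simp only [covD, Pi.add_apply]
  ring

/-- kernel: … and homogeneous. [folklore] -/
private theorem holderExpr_smul (w : ℂ) (c : ℝ) (u : PBond P 0 → ℂ) (z : ℂ) (φ : Balaban1983to89.Site P 0 → ℂ) (b b' : PBond P 0) :
    w * covD c u (z • φ) b' - covD c u (z • φ) b = z * (w * covD c u φ b' - covD c u φ b) := by
  simp only [covD, Pi.smul_apply, smul_eq_mul]
  ring

/-- **[BalabanImbrieJaffe1985] p.326 «The propagators arising from Δ_k(u_k) … also satisfy the REGULARITY and decay estimates of [7]» — THE HÖLDER
MEMBER [7] (1.9) = [B1] Prop. 2.1 (2.24) «1/|x − x′|^α |U(A(Γ_{x,x′}))(D^η_{A,μ}G_k(Ω, A)f)(x′) − (D^η_{A,μ}G_k(Ω, A)f)(x)| ≦ c₀exp(−δ₀ dist({x, x′},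
supp f))‖f‖_∞ for x, x′ ∈ Ω, … dist({x, x′}, Ω^c) ≧ R₀» FOR THE REGION NEUMANN PROPAGATORS `G_k(Ω,u)` OF [BalabanImbrieJaffe1988] (2.27) AT
`u = e^{ieεA}`.**  For `d ≧ 1`, `L ≧ 2`, `a > 0`, a charge `e` and a regularity pair `(c, β)` there is `s₀` such that for every `0 ≦ α < 1` and every
`s ≧ s₀` there are `c₀, e₁ > 0` (depending on `d, a, L^s, α` — «c₀ on α also») such that on every `Setup` torus, at every level `1 ≦ k ≦ K` with
`k + s ≦ m + K`, `3L^kL^s ≦ 2L^{m+K}`, for every union `Ω` of big blocks (`L^k·L^s` sites per side), every `A` with `L^kε·|e|/e_k·|A(⟨z+e_μ,ν⟩) −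
A(⟨z,ν⟩)| ≦ c·e_k^{β−1}/L^k` on `Ω` (`0 < e_k ≦ e₁`), every direction `μ`, all sites `x ≠ x′` with `{y : |y − x| ≦ R₀′}`, `{y : |y − x′| ≦ R₀′} ⊂ Ω`
(`R₀′ = 2rS + 2L^kL^s(d+1) + 1`), every nearest-neighbour contour `Γ = (x, l)` from `x` to `x′` of length `≦ d|x − x′|_∞` and every `f` with
`|f| ≦ M`, `f = 0` on `{|z − x| < D} ∪ {|z − x′| < D}` (only `1_Ωf` matters):
`((|x − x′|_∞/L^k)⁻¹)^α · ‖U(A(Γ))·ε⁻¹(u_{⟨x′,μ⟩}(G f)(x′+e_μ) − (G f)(x′)) − ε⁻¹(u_{⟨x,μ⟩}(G f)(x+e_μ) − (G f)(x))‖ ≦ c₀(L^kε)·exp(−D/(4L^s·L^k))·M`,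
`G = gBox (α_kL^{kd}) ε⁻¹ u k Ω`, `u = expGauge e A`, `U(A(Γ)) = holA e A x l`, the covariant derivative = r18's `covD P.eps⁻¹ (cfg u)`.  PROOF:
p35's `B1Ineq224RegularRegion.norm_holder_propagatorK_region_reg_decay_sum` BY NAME at `m² = 1` on the `tε`-tori (§2), the resolvent identity
`G f = ψ_{t²}(1_Ωf) + t²ψ_{t²}(G f)` and `t ↓ 0`. [cite: BalabanImbrieJaffe1985, p.326 «also satisfy the regularity and decay estimates of [7]»]
[cite: Balaban1983RegularityDecay, Theorem p.573 (1.9)] [cite: Balaban1982Higgs1, Prop. 2.1 (2.24) p.610] -/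
theorem holder_covD_gBox_le (d L : ℕ) (hd : 1 ≤ d) (hL : 2 ≤ L) {a : ℝ} (ha : 0 < a) (e creg β : ℝ) (hcreg : 0 ≤ creg)
    (hβ : 0 < β) :
    ∃ s₀ : ℕ, ∀ {α : ℝ}, 0 ≤ α → α < 1 → ∀ s : ℕ, s₀ ≤ s → ∃ c₀ e₁ : ℝ, 0 < c₀ ∧ 0 < e₁ ∧
      ∀ (P : Params), P.d = d → P.L = L → ∀ {k : ℕ}, 1 ≤ k → k ≤ P.K → k + s ≤ P.m + P.K →
      3 * (L ^ k * L ^ s) ≤ P.sitesPerDir 0 →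
      ∀ (Ω : Finset (Balaban1983to89.Site P 0)),
        (∀ z z' : Balaban1983to89.Site P 0,
          (∀ μ, (z μ).val / (L ^ k * L ^ s) = (z' μ).val / (L ^ k * L ^ s)) → (z ∈ Ω ↔ z' ∈ Ω)) →
      ∀ (A : PBond P 0 → ℝ) {ec : ℝ}, 0 < ec → ec ≤ e₁ →
      (∀ z ∈ Ω, ∀ μ ν : Fin P.d,
          P.spacing k * |e| / ec * |A ⟨z.shift μ, ν⟩ - A ⟨z, ν⟩| ≤ creg * ec ^ (β - 1) / (L : ℝ) ^ k) →
      ∀ (μ : Fin P.d) (x x' : Balaban1983to89.Site P 0), x' ≠ x →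
        (∀ y, LatticeFieldCalculus.supDist x y
          ≤ 2 * (5 * (L ^ k * L ^ s) / 8 + L ^ k) + 2 * (L ^ k * L ^ s) * (d + 1) + 1 → y ∈ Ω) →
        (∀ y, LatticeFieldCalculus.supDist x' y
          ≤ 2 * (5 * (L ^ k * L ^ s) / 8 + L ^ k) + 2 * (L ^ k * L ^ s) * (d + 1) + 1 → y ∈ Ω) →
      ∀ (l : List (Balaban1983to89.Site P 0)), IsSChain x l → pathEnd x l = x' →
        (l.length : ℝ) ≤ (d : ℝ) * LatticeFieldCalculus.supDist x x' →
      ∀ (f : Balaban1983to89.Site P 0 → ℂ) (M D : ℝ), (∀ z, ‖f z‖ ≤ M) → 0 ≤ D →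
        (∀ z, f z ≠ 0 → D ≤ (LatticeFieldCalculus.supDist x z : ℝ)) → (∀ z, f z ≠ 0 → D ≤ (LatticeFieldCalculus.supDist x' z : ℝ)) →
        (((LatticeFieldCalculus.supDist x x' : ℝ) / (L : ℝ) ^ k)⁻¹) ^ α *
            ‖holA e A x l * covD P.eps⁻¹ (cfg (expGauge P e A))
                (gBox (B1RG242Torus.α P a k * (P.L : ℝ) ^ (k * P.d)) P.eps⁻¹ (expGauge P e A) k Ω *ᵥ f) ⟨x', μ⟩
              - covD P.eps⁻¹ (cfg (expGauge P e A))
                (gBox (B1RG242Torus.α P a k * (P.L : ℝ) ^ (k * P.d)) P.eps⁻¹ (expGauge P e A) k Ω *ᵥ f) ⟨x, μ⟩‖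
          ≤ c₀ * P.spacing k * Real.exp (-(D / (4 * (L : ℝ) ^ s * (L : ℝ) ^ k))) * M := by
  obtain ⟨K₁, hK₁⟩ := B1Ineq224RegularRegion.norm_holder_propagatorK_region_reg_decay_sum d L hd hL ha one_pos 2 (rotCharge e) 1
    creg β hcreg hβ
  refine ⟨K₁, fun {α} hα0 hα1 s hs₀ => ?_⟩
  obtain ⟨c₁, e₁, hc₁, he₁, hB1h⟩ := hK₁ hα0 hα1 (L ^ s) (le_trans hs₀ (Nat.lt_pow_self (by omega : 1 < L)).le)
  refine ⟨c₁, e₁, hc₁, he₁, ?_⟩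
  intro P hPd hPL k hk1 hkK hks hsize Ω hbig A ec hec hece hreg μ x x' hne hint hint' l hch hend hlen f₀ M D hM₀ hD hsupp₀ hsupp₀'
  -- reduce to a source supported in `Ω`: `G_k(Ω,u)·1_Ω = G_k(Ω,u)`
  rw [show gBox (B1RG242Torus.α P a k * (P.L : ℝ) ^ (k * P.d)) P.eps⁻¹ (expGauge P e A) k Ω *ᵥ f₀
      = gBox (B1RG242Torus.α P a k * (P.L : ℝ) ^ (k * P.d)) P.eps⁻¹ (expGauge P e A) k Ω *ᵥ (proj Ω *ᵥ f₀) by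
    rw [mulVec_mulVec, BIJ88NeumannPropagator227Torus.gBox_mul_proj]]
  set f := proj Ω *ᵥ f₀ with hf_def
  have hf : ∀ z, z ∉ Ω → f z = 0 := fun z hz => by rw [hf_def, proj_mulVec, if_neg hz]
  have hM : ∀ z, ‖f z‖ ≤ M := fun z => by
    rw [hf_def, proj_mulVec]
    split_ifs
    · exact hM₀ z
    · rw [norm_zero]; exact (norm_nonneg _).trans (hM₀ x)
  have hsupp : ∀ z, f z ≠ 0 → D ≤ (LatticeFieldCalculus.supDist x z : ℝ) := fun z hz => hsupp₀ z (by
    rw [hf_def, proj_mulVec] at hz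
    split_ifs at hz with hzΩ
    · exact hz
    · exact absurd rfl hz)
  have hsupp' : ∀ z, f z ≠ 0 → D ≤ (LatticeFieldCalculus.supDist x' z : ℝ) := fun z hz => hsupp₀' z (by
    rw [hf_def, proj_mulVec] at hz
    split_ifs at hz with hzΩ
    · exact hz
    · exact absurd rfl hz)
  have hak : 0 ≤ B1.aSeq a (P.L : ℝ) k := (B1.aSeq_pos ha (B1RG242Torus.one_lt_cast_L P) hk1).le
  have hα : 0 < B1RG242Torus.α P a k * (P.L : ℝ) ^ (k * P.d) :=
    mul_pos (mul_pos (B1.aSeq_pos ha (B1RG242Torus.one_lt_cast_L P) hk1) (inv_pos.2 (pow_pos (P.spacing_pos k) 2)))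
      (pow_pos P.cast_L_pos _)
  have hs : 0 + s ≤ P.m + P.K := by omega
  have hbig' : ∀ z z' : Balaban1983to89.Site P 0,
      (∀ μ, (z μ).val / (P.L ^ k * P.L ^ s) = (z' μ).val / (P.L ^ k * P.L ^ s)) → (z ∈ Ω ↔ z' ∈ Ω) := by
    rw [hPL]; exact hbig
  have hΩ : IsBlockUnion k Ω := isBlockUnion_of_bigBlocks (s := s) (by omega) hbig'
  have hN := isUnit_nPad (j := 0) (by omega) (inv_ne_zero P.eps_pos.ne') hα (expGauge P e A) hΩ
  -- `g = G_k(Ω,u)f`: supported in `Ω`, `nOp g = f`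
  set g := gBox (B1RG242Torus.α P a k * (P.L : ℝ) ^ (k * P.d)) P.eps⁻¹ (expGauge P e A) k Ω *ᵥ f with hg
  have hgsupp : ∀ z, z ∉ Ω → g z = 0 := fun z hz => gBox_mulVec_eq_zero_of_not_mem hN f hz
  have hNg : nOp (B1RG242Torus.α P a k * (P.L : ℝ) ^ (k * P.d)) P.eps⁻¹ (expGauge P e A) k Ω *ᵥ g = f := by
    rw [hg, mulVec_mulVec, nOp_mul_gBox hN, proj_mulVec_eq_self hf]
  set q : ℝ := (((LatticeFieldCalculus.supDist x x' : ℝ) / (L : ℝ) ^ k)⁻¹) ^ α with hq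
  have hq0 : 0 ≤ q := Real.rpow_nonneg (inv_nonneg.2 (div_nonneg (Nat.cast_nonneg _)
    (pow_nonneg (by exact_mod_cast (show 0 ≤ L by omega)) _))) α
  -- at every `τ = t² ∈ (0,1]`
  have key : ∀ τ : ℝ, 0 < τ → τ ≤ 1 →
      q * ‖holA e A x l * covD P.eps⁻¹ (cfg (expGauge P e A)) g ⟨x', μ⟩ - covD P.eps⁻¹ (cfg (expGauge P e A)) g ⟨x, μ⟩‖
        ≤ c₁ * P.spacing k * Real.exp (-(D / (4 * (L : ℝ) ^ s * (L : ℝ) ^ k))) * M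
          + τ * (c₁ * P.spacing k * Real.exp (-(0 / (4 * (L : ℝ) ^ s * (L : ℝ) ^ k))) * ∑ z, ‖g z‖) := by
    intro τ hτ hτ1
    obtain ⟨t, ht, ht1, htt⟩ : ∃ t : ℝ, 0 < t ∧ t ≤ 1 ∧ t ^ 2 = τ :=
      ⟨Real.sqrt τ, Real.sqrt_pos.2 hτ, by rw [← Real.sqrt_one]; exact Real.sqrt_le_sqrt hτ1, Real.sq_sqrt hτ.le⟩
    have ht2 : ((t ^ 2 : ℝ) : ℂ) ≠ 0 := Complex.ofReal_ne_zero.2 (pow_pos ht 2).ne'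
    have hU := isUnit_nOp_add_mass hs hks e A (pow_pos ht 2) hak hΩ
    have happ : ∀ φ : Balaban1983to89.Site P 0 → ℂ,
        (nOp (B1RG242Torus.α P a k * (P.L : ℝ) ^ (k * P.d)) P.eps⁻¹ (expGauge P e A) k Ω
            + ((t ^ 2 : ℝ) : ℂ) • (1 : Matrix (Balaban1983to89.Site P 0) (Balaban1983to89.Site P 0) ℂ)) *ᵥ φ
          = nOp (B1RG242Torus.α P a k * (P.L : ℝ) ^ (k * P.d)) P.eps⁻¹ (expGauge P e A) k Ω *ᵥ φ + ((t ^ 2 : ℝ) : ℂ) • φ :=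
      fun φ => by rw [add_mulVec, smul_mulVec, one_mulVec]
    obtain ⟨ψf, hTf⟩ := (Matrix.mulVec_surjective_iff_isUnit.2 hU) f
    obtain ⟨ψg, hTg⟩ := (Matrix.mulVec_surjective_iff_isUnit.2 hU) g
    have hψf : nOp (B1RG242Torus.α P a k * (P.L : ℝ) ^ (k * P.d)) P.eps⁻¹ (expGauge P e A) k Ω *ᵥ ψf
        + ((t ^ 2 : ℝ) : ℂ) • ψf = f := by rw [← happ]; exact hTf
    have hψg : nOp (B1RG242Torus.α P a k * (P.L : ℝ) ^ (k * P.d)) P.eps⁻¹ (expGauge P e A) k Ω *ᵥ ψg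
        + ((t ^ 2 : ℝ) : ℂ) • ψg = g := by rw [← happ]; exact hTg
    have hsf := support_of_massive_eq _ _ _ Ω ht2 hf hψf
    have hsg := support_of_massive_eq _ _ _ Ω ht2 hgsupp hψg
    have hres : g = ψf + ((t ^ 2 : ℝ) : ℂ) • ψg := by
      apply Matrix.mulVec_injective_iff_isUnit.2 hU
      show _ *ᵥ g = _ *ᵥ (ψf + ((t ^ 2 : ℝ) : ℂ) • ψg)
      rw [mulVec_add, mulVec_smul, hTf, hTg, happ, hNg]
    have hBf := holder_massive_solution_le d L s ha e creg β c₁ e₁ hB1h P hPd hPL hs hk1 hkK hks hsize hbig A hec hece hreg μ x x'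
      hne hint hint' l hch hend hlen ht ht1 hsf hf hψf M D hM hD hsupp hsupp'
    have hBg := holder_massive_solution_le d L s ha e creg β c₁ e₁ hB1h P hPd hPL hs hk1 hkK hks hsize hbig A hec hece hreg μ x x'
      hne hint hint' l hch hend hlen ht ht1 hsg hgsupp hψg (∑ z, ‖g z‖) 0
      (fun z => Finset.single_le_sum (fun w _ => norm_nonneg (g w)) (Finset.mem_univ z)) le_rfl
      (fun z _ => Nat.cast_nonneg _) (fun z _ => Nat.cast_nonneg _)
    have hcg : holA e A x l * covD P.eps⁻¹ (cfg (expGauge P e A)) g ⟨x', μ⟩ - covD P.eps⁻¹ (cfg (expGauge P e A)) g ⟨x, μ⟩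
        = (holA e A x l * covD P.eps⁻¹ (cfg (expGauge P e A)) ψf ⟨x', μ⟩ - covD P.eps⁻¹ (cfg (expGauge P e A)) ψf ⟨x, μ⟩)
          + ((t ^ 2 : ℝ) : ℂ) * (holA e A x l * covD P.eps⁻¹ (cfg (expGauge P e A)) ψg ⟨x', μ⟩
            - covD P.eps⁻¹ (cfg (expGauge P e A)) ψg ⟨x, μ⟩) := by
      rw [← holderExpr_smul, ← holderExpr_add, ← hres]
    rw [hcg]
    calc _ ≤ q * (‖holA e A x l * covD P.eps⁻¹ (cfg (expGauge P e A)) ψf ⟨x', μ⟩ - covD P.eps⁻¹ (cfg (expGauge P e A)) ψf ⟨x, μ⟩‖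
          + ‖((t ^ 2 : ℝ) : ℂ) * (holA e A x l * covD P.eps⁻¹ (cfg (expGauge P e A)) ψg ⟨x', μ⟩
            - covD P.eps⁻¹ (cfg (expGauge P e A)) ψg ⟨x, μ⟩)‖) := mul_le_mul_of_nonneg_left (norm_add_le _ _) hq0
      _ = q * ‖holA e A x l * covD P.eps⁻¹ (cfg (expGauge P e A)) ψf ⟨x', μ⟩ - covD P.eps⁻¹ (cfg (expGauge P e A)) ψf ⟨x, μ⟩‖
          + t ^ 2 * (q * ‖holA e A x l * covD P.eps⁻¹ (cfg (expGauge P e A)) ψg ⟨x', μ⟩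
            - covD P.eps⁻¹ (cfg (expGauge P e A)) ψg ⟨x, μ⟩‖) := by
          rw [norm_mul, Complex.norm_real, Real.norm_of_nonneg (pow_pos ht 2).le]; ring
      _ ≤ _ := by rw [htt]; exact add_le_add hBf (mul_le_mul_of_nonneg_left hBg hτ.le)
  -- `τ ↓ 0`
  refine le_of_forall_pos_le_add fun ε hε => ?_
  have hsk : 0 < P.spacing k := P.spacing_pos k
  set Bg := c₁ * P.spacing k * Real.exp (-(0 / (4 * (L : ℝ) ^ s * (L : ℝ) ^ k))) * ∑ z, ‖g z‖ with hBg_def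
  have hBg0 : 0 ≤ Bg := by positivity
  have h := key (min 1 (ε / (Bg + 1))) (lt_min one_pos (div_pos hε (by linarith))) (min_le_left _ _)
  refine h.trans (add_le_add le_rfl ?_)
  calc min 1 (ε / (Bg + 1)) * Bg ≤ ε / (Bg + 1) * Bg := mul_le_mul_of_nonneg_right (min_le_right _ _) hBg0
    _ ≤ ε := by
      rw [div_mul_eq_mul_div, div_le_iff₀ (by linarith)]
      nlinarith

/-- **THE WHOLE TORUS `Ω = T^{(0)}`, HÖLDER MEMBER** («in the case Ω = T_η the condition dist({x,x′},Ω^c) ≧ R₀ is meaningless and is omitted»):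
the same bound for p31's `gBox … k univ` at `u = e^{ieεA}`, `A` regular on `T^{(0)}`, every pair `x ≠ x′`, every admissible contour.
[cite: BalabanImbrieJaffe1985, p.326 «also satisfy the regularity and decay estimates of [7]»] [cite: Balaban1983RegularityDecay, Theorem p.573 (1.9)] -/
theorem holder_covD_gBox_univ_le (d L : ℕ) (hd : 1 ≤ d) (hL : 2 ≤ L) {a : ℝ} (ha : 0 < a) (e creg β : ℝ) (hcreg : 0 ≤ creg)
    (hβ : 0 < β) :
    ∃ s₀ : ℕ, ∀ {α : ℝ}, 0 ≤ α → α < 1 → ∀ s : ℕ, s₀ ≤ s → ∃ c₀ e₁ : ℝ, 0 < c₀ ∧ 0 < e₁ ∧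
      ∀ (P : Params), P.d = d → P.L = L → ∀ {k : ℕ}, 1 ≤ k → k ≤ P.K → k + s ≤ P.m + P.K →
      3 * (L ^ k * L ^ s) ≤ P.sitesPerDir 0 →
      ∀ (A : PBond P 0 → ℝ) {ec : ℝ}, 0 < ec → ec ≤ e₁ →
      (∀ (z : Balaban1983to89.Site P 0) (μ ν : Fin P.d),
          P.spacing k * |e| / ec * |A ⟨z.shift μ, ν⟩ - A ⟨z, ν⟩| ≤ creg * ec ^ (β - 1) / (L : ℝ) ^ k) →
      ∀ (μ : Fin P.d) (x x' : Balaban1983to89.Site P 0), x' ≠ x →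
      ∀ (l : List (Balaban1983to89.Site P 0)), IsSChain x l → pathEnd x l = x' →
        (l.length : ℝ) ≤ (d : ℝ) * LatticeFieldCalculus.supDist x x' →
      ∀ (f : Balaban1983to89.Site P 0 → ℂ) (M D : ℝ), (∀ z, ‖f z‖ ≤ M) → 0 ≤ D →
        (∀ z, f z ≠ 0 → D ≤ (LatticeFieldCalculus.supDist x z : ℝ)) → (∀ z, f z ≠ 0 → D ≤ (LatticeFieldCalculus.supDist x' z : ℝ)) →
        (((LatticeFieldCalculus.supDist x x' : ℝ) / (L : ℝ) ^ k)⁻¹) ^ α *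
            ‖holA e A x l * covD P.eps⁻¹ (cfg (expGauge P e A))
                (gBox (B1RG242Torus.α P a k * (P.L : ℝ) ^ (k * P.d)) P.eps⁻¹ (expGauge P e A) k Finset.univ *ᵥ f) ⟨x', μ⟩
              - covD P.eps⁻¹ (cfg (expGauge P e A))
                (gBox (B1RG242Torus.α P a k * (P.L : ℝ) ^ (k * P.d)) P.eps⁻¹ (expGauge P e A) k Finset.univ *ᵥ f) ⟨x, μ⟩‖
          ≤ c₀ * P.spacing k * Real.exp (-(D / (4 * (L : ℝ) ^ s * (L : ℝ) ^ k))) * M := by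
  obtain ⟨s₀, hs₀⟩ := holder_covD_gBox_le d L hd hL ha e creg β hcreg hβ
  refine ⟨s₀, fun {α} hα0 hα1 s hs => ?_⟩
  obtain ⟨c₀, e₁, hc₀, he₁, hmain⟩ := hs₀ hα0 hα1 s hs
  refine ⟨c₀, e₁, hc₀, he₁, ?_⟩
  intro P hPd hPL k hk1 hkK hks hsize A ec hec hece hreg μ x x' hne l hch hend hlen f M D hM hD hsupp hsupp'
  exact hmain P hPd hPL hk1 hkK hks hsize Finset.univ (fun z z' _ => by simp only [Finset.mem_univ]) A hec hece
    (fun z _ μ ν => hreg z μ ν) μ x x' hne (fun y _ => Finset.mem_univ y) (fun y _ => Finset.mem_univ y) l hch hend hlen f M D hM hD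
    hsupp hsupp'

end Holder

/-! ## §4 The Hölder member of the `δG_k(Ω, Ω₀)` clause at `u = e^{ieεA}`, `A` regular -/

section Close

variable {P : Params}

/-- **THE HÖLDER MEMBER OF THE `δG` CLAUSE [7] (1.11)–(1.12) = [B1] Prop. 2.1 (2.26) «(2.24) … with the additional factor exp(−δ₀ dist(supp f, Ω^c)
− δ₀ dist({x, x′}, Ω^c))» FOR THE REGION NEUMANN PROPAGATORS OF [BalabanImbrieJaffe1988] (2.27) ON NESTED BIG-BLOCK REGIONS `Ω ⊆ Ω₀` AT
`u = e^{ieεA}`.**  With the constant structure of `holder_covD_gBox_le` (`s₀`; `c₀, e₁` after `α`, `s`), for `Ω ⊆ Ω₀` unions of big blocks, `A`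
(2.23)-regular on `Ω₀`, `x ≠ x′` both with `{|y − ·| ≦ R₀′} ⊂ Ω`, a contour `Γ = (x,l)` to `x′` of length `≦ d|x − x′|_∞`, `f` supported in `Ω`
with `|f| ≦ M` vanishing within `D` of `x` and of `x′`, `D₀ ≦ dist({x,x′},T∖Ω)`, `D₁ ≦ dist(supp f,T∖Ω)`, every `μ`:
`((|x−x′|_∞/L^k)⁻¹)^α·‖U(A(Γ))(D_u(G_k(Ω,u)f − G_k(Ω₀,u)f))(x′,μ) − (D_u(G_k(Ω,u)f − G_k(Ω₀,u)f))(x,μ)‖ ≦ c₀(L^kε)·e^{−(D+D₀+D₁)/(8L^sL^k)}·M`.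
PROOF: p35's `B1Ineq226HolderRegularRegion.holder_deltaG_region_reg_decay_sum` BY NAME (§2 `holder_massive_diff_le`), the massive problems on `Ω`,
`Ω₀`, the two resolvent identities, §2 `holder_massive_solution_le` (D = 0) for the `t²`-terms, `t ↓ 0`.
[cite: BalabanImbrieJaffe1985, p.326 «also satisfy the regularity and decay estimates of [7]»]
[cite: Balaban1983RegularityDecay, Theorem p.573 (1.11)–(1.12)] [cite: Balaban1982Higgs1, Prop. 2.1 (2.26) pp.610–611] -/
theorem holder_covD_gBox_sub_gBox_le (d L : ℕ) (hd : 1 ≤ d) (hL : 2 ≤ L) {a : ℝ} (ha : 0 < a) (e creg β : ℝ) (hcreg : 0 ≤ creg)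
    (hβ : 0 < β) :
    ∃ s₀ : ℕ, ∀ {α : ℝ}, 0 ≤ α → α < 1 → ∀ s : ℕ, s₀ ≤ s → ∃ c₀ e₁ : ℝ, 0 < c₀ ∧ 0 < e₁ ∧
      ∀ (P : Params), P.d = d → P.L = L → ∀ {k : ℕ}, 1 ≤ k → k ≤ P.K → k + s ≤ P.m + P.K →
      3 * (L ^ k * L ^ s) ≤ P.sitesPerDir 0 →
      ∀ (Ω Ω₀ : Finset (Balaban1983to89.Site P 0)),
        (∀ z z' : Balaban1983to89.Site P 0,
          (∀ μ, (z μ).val / (L ^ k * L ^ s) = (z' μ).val / (L ^ k * L ^ s)) → (z ∈ Ω ↔ z' ∈ Ω)) →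
        (∀ z z' : Balaban1983to89.Site P 0,
          (∀ μ, (z μ).val / (L ^ k * L ^ s) = (z' μ).val / (L ^ k * L ^ s)) → (z ∈ Ω₀ ↔ z' ∈ Ω₀)) →
        Ω ⊆ Ω₀ →
      ∀ (A : PBond P 0 → ℝ) {ec : ℝ}, 0 < ec → ec ≤ e₁ →
      (∀ z ∈ Ω₀, ∀ μ ν : Fin P.d,
          P.spacing k * |e| / ec * |A ⟨z.shift μ, ν⟩ - A ⟨z, ν⟩| ≤ creg * ec ^ (β - 1) / (L : ℝ) ^ k) →
      ∀ (μ : Fin P.d) (x x' : Balaban1983to89.Site P 0), x' ≠ x →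
        (∀ y, LatticeFieldCalculus.supDist x y
          ≤ 2 * (5 * (L ^ k * L ^ s) / 8 + L ^ k) + 2 * (L ^ k * L ^ s) * (d + 1) + 1 → y ∈ Ω) →
        (∀ y, LatticeFieldCalculus.supDist x' y
          ≤ 2 * (5 * (L ^ k * L ^ s) / 8 + L ^ k) + 2 * (L ^ k * L ^ s) * (d + 1) + 1 → y ∈ Ω) →
      ∀ (l : List (Balaban1983to89.Site P 0)), IsSChain x l → pathEnd x l = x' →
        (l.length : ℝ) ≤ (d : ℝ) * LatticeFieldCalculus.supDist x x' →
      ∀ (f : Balaban1983to89.Site P 0 → ℂ) (M D D₀ D₁ : ℝ), (∀ z, ‖f z‖ ≤ M) → (∀ z, z ∉ Ω → f z = 0) →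
        0 ≤ D → 0 ≤ D₀ → 0 ≤ D₁ →
        (∀ z, f z ≠ 0 → D ≤ (LatticeFieldCalculus.supDist x z : ℝ)) → (∀ z, f z ≠ 0 → D ≤ (LatticeFieldCalculus.supDist x' z : ℝ)) →
        (∀ z, z ∉ Ω → D₀ ≤ (LatticeFieldCalculus.supDist x z : ℝ)) → (∀ z, z ∉ Ω → D₀ ≤ (LatticeFieldCalculus.supDist x' z : ℝ)) →
        (∀ y z, f y ≠ 0 → z ∉ Ω → D₁ ≤ (LatticeFieldCalculus.supDist z y : ℝ)) →
        (((LatticeFieldCalculus.supDist x x' : ℝ) / (L : ℝ) ^ k)⁻¹) ^ α *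
            ‖holA e A x l * covD P.eps⁻¹ (cfg (expGauge P e A))
                (gBox (B1RG242Torus.α P a k * (P.L : ℝ) ^ (k * P.d)) P.eps⁻¹ (expGauge P e A) k Ω *ᵥ f
                  - gBox (B1RG242Torus.α P a k * (P.L : ℝ) ^ (k * P.d)) P.eps⁻¹ (expGauge P e A) k Ω₀ *ᵥ f) ⟨x', μ⟩
              - covD P.eps⁻¹ (cfg (expGauge P e A))
                (gBox (B1RG242Torus.α P a k * (P.L : ℝ) ^ (k * P.d)) P.eps⁻¹ (expGauge P e A) k Ω *ᵥ f
                  - gBox (B1RG242Torus.α P a k * (P.L : ℝ) ^ (k * P.d)) P.eps⁻¹ (expGauge P e A) k Ω₀ *ᵥ f) ⟨x, μ⟩‖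
          ≤ c₀ * P.spacing k * Real.exp (-((D + D₀ + D₁) / (8 * (L : ℝ) ^ s * (L : ℝ) ^ k))) * M := by
  obtain ⟨K₁, hK₁⟩ := B1Ineq224RegularRegion.norm_holder_propagatorK_region_reg_decay_sum d L hd hL ha one_pos 2 (rotCharge e) 1
    creg β hcreg hβ
  obtain ⟨K₂, hK₂⟩ := B1Ineq226HolderRegularRegion.holder_deltaG_region_reg_decay_sum d L hd hL ha one_pos 2 (rotCharge e) 1
    creg β hcreg hβ
  refine ⟨max K₁ K₂, fun {α} hα0 hα1 s hs₀ => ?_⟩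
  have hLs : s ≤ L ^ s := (Nat.lt_pow_self (by omega : 1 < L)).le
  obtain ⟨c₁, e₁, hc₁, he₁, hB1h⟩ := hK₁ hα0 hα1 (L ^ s) (le_trans (le_trans (le_max_left _ _) hs₀) hLs)
  obtain ⟨c₂, e₂, hc₂, he₂, hB2h⟩ := hK₂ hα0 hα1 (L ^ s) (le_trans (le_trans (le_max_right _ _) hs₀) hLs)
  refine ⟨c₂, min e₁ e₂, hc₂, lt_min he₁ he₂, ?_⟩
  intro P hPd hPL k hk1 hkK hks hsize Ω Ω₀ hbig hbig₀ hsub A ec hec hece hreg μ x x' hne hint hint' l hch hend hlen f M D D₀ D₁ hM hf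
    hD hD₀ hD₁ hsupp hsupp' hxD₀ hxD₀' hfD₁
  have hece₁ : ec ≤ e₁ := hece.trans (min_le_left _ _)
  have hece₂ : ec ≤ e₂ := hece.trans (min_le_right _ _)
  have hak : 0 ≤ B1.aSeq a (P.L : ℝ) k := (B1.aSeq_pos ha (B1RG242Torus.one_lt_cast_L P) hk1).le
  have hα' : 0 < B1RG242Torus.α P a k * (P.L : ℝ) ^ (k * P.d) :=
    mul_pos (mul_pos (B1.aSeq_pos ha (B1RG242Torus.one_lt_cast_L P) hk1) (inv_pos.2 (pow_pos (P.spacing_pos k) 2)))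
      (pow_pos P.cast_L_pos _)
  have hs : 0 + s ≤ P.m + P.K := by omega
  have hbig' : ∀ z z' : Balaban1983to89.Site P 0,
      (∀ μ, (z μ).val / (P.L ^ k * P.L ^ s) = (z' μ).val / (P.L ^ k * P.L ^ s)) → (z ∈ Ω ↔ z' ∈ Ω) := by
    rw [hPL]; exact hbig
  have hbig₀' : ∀ z z' : Balaban1983to89.Site P 0,
      (∀ μ, (z μ).val / (P.L ^ k * P.L ^ s) = (z' μ).val / (P.L ^ k * P.L ^ s)) → (z ∈ Ω₀ ↔ z' ∈ Ω₀) := by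
    rw [hPL]; exact hbig₀
  have hΩ : IsBlockUnion k Ω := isBlockUnion_of_bigBlocks (s := s) (by omega) hbig'
  have hΩ₀ : IsBlockUnion k Ω₀ := isBlockUnion_of_bigBlocks (s := s) (by omega) hbig₀'
  have hN := isUnit_nPad (j := 0) (by omega) (inv_ne_zero P.eps_pos.ne') hα' (expGauge P e A) hΩ
  have hN₀ := isUnit_nPad (j := 0) (by omega) (inv_ne_zero P.eps_pos.ne') hα' (expGauge P e A) hΩ₀
  have hregΩ : ∀ z ∈ Ω, ∀ μ ν : Fin P.d,
      P.spacing k * |e| / ec * |A ⟨z.shift μ, ν⟩ - A ⟨z, ν⟩| ≤ creg * ec ^ (β - 1) / (L : ℝ) ^ k :=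
    fun z hz => hreg z (hsub hz)
  have hint₀ : ∀ y, LatticeFieldCalculus.supDist x y
      ≤ 2 * (5 * (L ^ k * L ^ s) / 8 + L ^ k) + 2 * (L ^ k * L ^ s) * (d + 1) + 1 → y ∈ Ω₀ :=
    fun y hy => hsub (hint y hy)
  have hint₀' : ∀ y, LatticeFieldCalculus.supDist x' y
      ≤ 2 * (5 * (L ^ k * L ^ s) / 8 + L ^ k) + 2 * (L ^ k * L ^ s) * (d + 1) + 1 → y ∈ Ω₀ :=
    fun y hy => hsub (hint' y hy)
  have hf₀ : ∀ z, z ∉ Ω₀ → f z = 0 := fun z hz => hf z fun hz' => hz (hsub hz')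
  set g := gBox (B1RG242Torus.α P a k * (P.L : ℝ) ^ (k * P.d)) P.eps⁻¹ (expGauge P e A) k Ω *ᵥ f with hg
  set g₀ := gBox (B1RG242Torus.α P a k * (P.L : ℝ) ^ (k * P.d)) P.eps⁻¹ (expGauge P e A) k Ω₀ *ᵥ f with hg₀
  have hgsupp : ∀ z, z ∉ Ω → g z = 0 := fun z hz => gBox_mulVec_eq_zero_of_not_mem hN f hz
  have hg₀supp : ∀ z, z ∉ Ω₀ → g₀ z = 0 := fun z hz => gBox_mulVec_eq_zero_of_not_mem hN₀ f hz
  have hNg : nOp (B1RG242Torus.α P a k * (P.L : ℝ) ^ (k * P.d)) P.eps⁻¹ (expGauge P e A) k Ω *ᵥ g = f := by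
    rw [hg, mulVec_mulVec, nOp_mul_gBox hN, proj_mulVec_eq_self hf]
  have hNg₀ : nOp (B1RG242Torus.α P a k * (P.L : ℝ) ^ (k * P.d)) P.eps⁻¹ (expGauge P e A) k Ω₀ *ᵥ g₀ = f := by
    rw [hg₀, mulVec_mulVec, nOp_mul_gBox hN₀, proj_mulVec_eq_self hf₀]
  set q : ℝ := (((LatticeFieldCalculus.supDist x x' : ℝ) / (L : ℝ) ^ k)⁻¹) ^ α with hq
  have hq0 : 0 ≤ q := Real.rpow_nonneg (inv_nonneg.2 (div_nonneg (Nat.cast_nonneg _)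
    (pow_nonneg (by exact_mod_cast (show 0 ≤ L by omega)) _))) α
  -- at every `τ = t² ∈ (0,1]`
  have key : ∀ τ : ℝ, 0 < τ → τ ≤ 1 →
      q * ‖holA e A x l * covD P.eps⁻¹ (cfg (expGauge P e A)) (g - g₀) ⟨x', μ⟩ - covD P.eps⁻¹ (cfg (expGauge P e A)) (g - g₀) ⟨x, μ⟩‖
        ≤ c₂ * P.spacing k * Real.exp (-((D + D₀ + D₁) / (8 * (L : ℝ) ^ s * (L : ℝ) ^ k))) * M
        + τ * (c₁ * P.spacing k * Real.exp (-(0 / (4 * (L : ℝ) ^ s * (L : ℝ) ^ k))) * ∑ z, ‖g z‖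
          + c₁ * P.spacing k * Real.exp (-(0 / (4 * (L : ℝ) ^ s * (L : ℝ) ^ k))) * ∑ z, ‖g₀ z‖) := by
    intro τ hτ hτ1
    obtain ⟨t, ht, ht1, htt⟩ : ∃ t : ℝ, 0 < t ∧ t ≤ 1 ∧ t ^ 2 = τ :=
      ⟨Real.sqrt τ, Real.sqrt_pos.2 hτ, by rw [← Real.sqrt_one]; exact Real.sqrt_le_sqrt hτ1, Real.sq_sqrt hτ.le⟩
    have ht2 : ((t ^ 2 : ℝ) : ℂ) ≠ 0 := Complex.ofReal_ne_zero.2 (pow_pos ht 2).ne'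
    have hU := isUnit_nOp_add_mass hs hks e A (pow_pos ht 2) hak hΩ
    have hU₀ := isUnit_nOp_add_mass hs hks e A (pow_pos ht 2) hak hΩ₀
    have happ : ∀ (X : Finset (Balaban1983to89.Site P 0)) (φ : Balaban1983to89.Site P 0 → ℂ),
        (nOp (B1RG242Torus.α P a k * (P.L : ℝ) ^ (k * P.d)) P.eps⁻¹ (expGauge P e A) k X
            + ((t ^ 2 : ℝ) : ℂ) • (1 : Matrix (Balaban1983to89.Site P 0) (Balaban1983to89.Site P 0) ℂ)) *ᵥ φ
          = nOp (B1RG242Torus.α P a k * (P.L : ℝ) ^ (k * P.d)) P.eps⁻¹ (expGauge P e A) k X *ᵥ φ + ((t ^ 2 : ℝ) : ℂ) • φ :=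
      fun X φ => by rw [add_mulVec, smul_mulVec, one_mulVec]
    obtain ⟨ψf, hTf⟩ := (Matrix.mulVec_surjective_iff_isUnit.2 hU) f
    obtain ⟨ψg, hTg⟩ := (Matrix.mulVec_surjective_iff_isUnit.2 hU) g
    obtain ⟨ψf₀, hTf₀⟩ := (Matrix.mulVec_surjective_iff_isUnit.2 hU₀) f
    obtain ⟨ψg₀, hTg₀⟩ := (Matrix.mulVec_surjective_iff_isUnit.2 hU₀) g₀
    have hψf : nOp (B1RG242Torus.α P a k * (P.L : ℝ) ^ (k * P.d)) P.eps⁻¹ (expGauge P e A) k Ω *ᵥ ψf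
        + ((t ^ 2 : ℝ) : ℂ) • ψf = f := by rw [← happ]; exact hTf
    have hψg : nOp (B1RG242Torus.α P a k * (P.L : ℝ) ^ (k * P.d)) P.eps⁻¹ (expGauge P e A) k Ω *ᵥ ψg
        + ((t ^ 2 : ℝ) : ℂ) • ψg = g := by rw [← happ]; exact hTg
    have hψf₀ : nOp (B1RG242Torus.α P a k * (P.L : ℝ) ^ (k * P.d)) P.eps⁻¹ (expGauge P e A) k Ω₀ *ᵥ ψf₀
        + ((t ^ 2 : ℝ) : ℂ) • ψf₀ = f := by rw [← happ]; exact hTf₀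
    have hψg₀ : nOp (B1RG242Torus.α P a k * (P.L : ℝ) ^ (k * P.d)) P.eps⁻¹ (expGauge P e A) k Ω₀ *ᵥ ψg₀
        + ((t ^ 2 : ℝ) : ℂ) • ψg₀ = g₀ := by rw [← happ]; exact hTg₀
    have hsf := support_of_massive_eq _ _ _ Ω ht2 hf hψf
    have hsg := support_of_massive_eq _ _ _ Ω ht2 hgsupp hψg
    have hsf₀ := support_of_massive_eq _ _ _ Ω₀ ht2 hf₀ hψf₀
    have hsg₀ := support_of_massive_eq _ _ _ Ω₀ ht2 hg₀supp hψg₀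
    have hres : g = ψf + ((t ^ 2 : ℝ) : ℂ) • ψg := by
      apply Matrix.mulVec_injective_iff_isUnit.2 hU
      show _ *ᵥ g = _ *ᵥ (ψf + ((t ^ 2 : ℝ) : ℂ) • ψg)
      rw [mulVec_add, mulVec_smul, hTf, hTg, happ, hNg]
    have hres₀ : g₀ = ψf₀ + ((t ^ 2 : ℝ) : ℂ) • ψg₀ := by
      apply Matrix.mulVec_injective_iff_isUnit.2 hU₀
      show _ *ᵥ g₀ = _ *ᵥ (ψf₀ + ((t ^ 2 : ℝ) : ℂ) • ψg₀)
      rw [mulVec_add, mulVec_smul, hTf₀, hTg₀, happ, hNg₀]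
    have hBd := holder_massive_diff_le d L s ha e creg β c₂ e₂ hB2h P hPd hPL hs hk1 hkK hks hsize hbig hbig₀ hsub A hec hece₂ hreg μ x x'
      hne hint hint' l hch hend hlen ht ht1 hsf hsf₀ hf hψf hψf₀ M D D₀ D₁ hM hD hD₀ hD₁ hsupp hsupp' hxD₀ hxD₀' hfD₁
    have hBg := holder_massive_solution_le d L s ha e creg β c₁ e₁ hB1h P hPd hPL hs hk1 hkK hks hsize hbig A hec hece₁ hregΩ μ x x'
      hne hint hint' l hch hend hlen ht ht1 hsg hgsupp hψg (∑ z, ‖g z‖) 0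
      (fun z => Finset.single_le_sum (fun w _ => norm_nonneg (g w)) (Finset.mem_univ z)) le_rfl
      (fun z _ => Nat.cast_nonneg _) (fun z _ => Nat.cast_nonneg _)
    have hBg₀ := holder_massive_solution_le d L s ha e creg β c₁ e₁ hB1h P hPd hPL hs hk1 hkK hks hsize hbig₀ A hec hece₁ hreg μ x x'
      hne hint₀ hint₀' l hch hend hlen ht ht1 hsg₀ hg₀supp hψg₀ (∑ z, ‖g₀ z‖) 0
      (fun z => Finset.single_le_sum (fun w _ => norm_nonneg (g₀ w)) (Finset.mem_univ z)) le_rfl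
      (fun z _ => Nat.cast_nonneg _) (fun z _ => Nat.cast_nonneg _)
    -- split the Hölder expression of `g − g₀ = (ψf − ψf₀) + t²(ψg − ψg₀)`; the pieces abbreviated
    set E := fun (φ : Balaban1983to89.Site P 0 → ℂ) =>
      holA e A x l * covD P.eps⁻¹ (cfg (expGauge P e A)) φ ⟨x', μ⟩ - covD P.eps⁻¹ (cfg (expGauge P e A)) φ ⟨x, μ⟩ with hEdef
    have hcg : E (g - g₀) = E (ψf - ψf₀) + ((t ^ 2 : ℝ) : ℂ) * (E ψg - E ψg₀) := by
      simp only [hEdef]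
      rw [hres, hres₀]
      simp only [covD, Pi.sub_apply, Pi.add_apply, Pi.smul_apply, smul_eq_mul]
      ring
    show q * ‖E (g - g₀)‖ ≤ _
    rw [hcg]
    have hEf : q * ‖E (ψf - ψf₀)‖ ≤ c₂ * P.spacing k * Real.exp (-((D + D₀ + D₁) / (8 * (L : ℝ) ^ s * (L : ℝ) ^ k))) * M := hBd
    have hEg : q * ‖E ψg‖ ≤ c₁ * P.spacing k * Real.exp (-(0 / (4 * (L : ℝ) ^ s * (L : ℝ) ^ k))) * ∑ z, ‖g z‖ := hBg
    have hEg₀ : q * ‖E ψg₀‖ ≤ c₁ * P.spacing k * Real.exp (-(0 / (4 * (L : ℝ) ^ s * (L : ℝ) ^ k))) * ∑ z, ‖g₀ z‖ := hBg₀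
    calc q * ‖E (ψf - ψf₀) + ((t ^ 2 : ℝ) : ℂ) * (E ψg - E ψg₀)‖
        ≤ q * (‖E (ψf - ψf₀)‖ + ‖((t ^ 2 : ℝ) : ℂ) * (E ψg - E ψg₀)‖) := mul_le_mul_of_nonneg_left (norm_add_le _ _) hq0
      _ ≤ q * (‖E (ψf - ψf₀)‖ + t ^ 2 * (‖E ψg‖ + ‖E ψg₀‖)) := by
          rw [norm_mul, Complex.norm_real, Real.norm_of_nonneg (pow_pos ht 2).le]
          exact mul_le_mul_of_nonneg_left (add_le_add le_rfl (mul_le_mul_of_nonneg_left (norm_sub_le _ _) (pow_pos ht 2).le)) hq0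
      _ = q * ‖E (ψf - ψf₀)‖ + t ^ 2 * (q * ‖E ψg‖ + q * ‖E ψg₀‖) := by ring
      _ ≤ _ := by rw [htt]; exact add_le_add hEf (mul_le_mul_of_nonneg_left (add_le_add hEg hEg₀) hτ.le)
  -- `τ ↓ 0`
  refine le_of_forall_pos_le_add fun ε hε => ?_
  have hsk : 0 < P.spacing k := P.spacing_pos k
  set Bg := c₁ * P.spacing k * Real.exp (-(0 / (4 * (L : ℝ) ^ s * (L : ℝ) ^ k))) * ∑ z, ‖g z‖
    + c₁ * P.spacing k * Real.exp (-(0 / (4 * (L : ℝ) ^ s * (L : ℝ) ^ k))) * ∑ z, ‖g₀ z‖ with hBg_def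
  have hBg0 : 0 ≤ Bg := by positivity
  have h := key (min 1 (ε / (Bg + 1))) (lt_min one_pos (div_pos hε (by linarith))) (min_le_left _ _)
  refine h.trans (add_le_add le_rfl ?_)
  calc min 1 (ε / (Bg + 1)) * Bg ≤ ε / (Bg + 1) * Bg := mul_le_mul_of_nonneg_right (min_le_right _ _) hBg0
    _ ≤ ε := by
      rw [div_mul_eq_mul_div, div_le_iff₀ (by linarith)]
      nlinarith

/-- **THE PAIR `Ω ⊂ Ω₀ = T^{(0)}`, HÖLDER MEMBER OF THE `δG` CLAUSE**: `A` regular on all of `T^{(0)}`, `Ω` a big-block union, the same data.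
[cite: BalabanImbrieJaffe1985, p.326 «also satisfy the regularity and decay estimates of [7]»] [cite: Balaban1983RegularityDecay, Theorem p.573 (1.11)–(1.12)] -/
theorem holder_covD_gBox_sub_gBox_univ_le (d L : ℕ) (hd : 1 ≤ d) (hL : 2 ≤ L) {a : ℝ} (ha : 0 < a) (e creg β : ℝ)
    (hcreg : 0 ≤ creg) (hβ : 0 < β) :
    ∃ s₀ : ℕ, ∀ {α : ℝ}, 0 ≤ α → α < 1 → ∀ s : ℕ, s₀ ≤ s → ∃ c₀ e₁ : ℝ, 0 < c₀ ∧ 0 < e₁ ∧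
      ∀ (P : Params), P.d = d → P.L = L → ∀ {k : ℕ}, 1 ≤ k → k ≤ P.K → k + s ≤ P.m + P.K →
      3 * (L ^ k * L ^ s) ≤ P.sitesPerDir 0 →
      ∀ (Ω : Finset (Balaban1983to89.Site P 0)),
        (∀ z z' : Balaban1983to89.Site P 0,
          (∀ μ, (z μ).val / (L ^ k * L ^ s) = (z' μ).val / (L ^ k * L ^ s)) → (z ∈ Ω ↔ z' ∈ Ω)) →
      ∀ (A : PBond P 0 → ℝ) {ec : ℝ}, 0 < ec → ec ≤ e₁ →
      (∀ (z : Balaban1983to89.Site P 0) (μ ν : Fin P.d),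
          P.spacing k * |e| / ec * |A ⟨z.shift μ, ν⟩ - A ⟨z, ν⟩| ≤ creg * ec ^ (β - 1) / (L : ℝ) ^ k) →
      ∀ (μ : Fin P.d) (x x' : Balaban1983to89.Site P 0), x' ≠ x →
        (∀ y, LatticeFieldCalculus.supDist x y
          ≤ 2 * (5 * (L ^ k * L ^ s) / 8 + L ^ k) + 2 * (L ^ k * L ^ s) * (d + 1) + 1 → y ∈ Ω) →
        (∀ y, LatticeFieldCalculus.supDist x' y
          ≤ 2 * (5 * (L ^ k * L ^ s) / 8 + L ^ k) + 2 * (L ^ k * L ^ s) * (d + 1) + 1 → y ∈ Ω) →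
      ∀ (l : List (Balaban1983to89.Site P 0)), IsSChain x l → pathEnd x l = x' →
        (l.length : ℝ) ≤ (d : ℝ) * LatticeFieldCalculus.supDist x x' →
      ∀ (f : Balaban1983to89.Site P 0 → ℂ) (M D D₀ D₁ : ℝ), (∀ z, ‖f z‖ ≤ M) → (∀ z, z ∉ Ω → f z = 0) →
        0 ≤ D → 0 ≤ D₀ → 0 ≤ D₁ →
        (∀ z, f z ≠ 0 → D ≤ (LatticeFieldCalculus.supDist x z : ℝ)) → (∀ z, f z ≠ 0 → D ≤ (LatticeFieldCalculus.supDist x' z : ℝ)) →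
        (∀ z, z ∉ Ω → D₀ ≤ (LatticeFieldCalculus.supDist x z : ℝ)) → (∀ z, z ∉ Ω → D₀ ≤ (LatticeFieldCalculus.supDist x' z : ℝ)) →
        (∀ y z, f y ≠ 0 → z ∉ Ω → D₁ ≤ (LatticeFieldCalculus.supDist z y : ℝ)) →
        (((LatticeFieldCalculus.supDist x x' : ℝ) / (L : ℝ) ^ k)⁻¹) ^ α *
            ‖holA e A x l * covD P.eps⁻¹ (cfg (expGauge P e A))
                (gBox (B1RG242Torus.α P a k * (P.L : ℝ) ^ (k * P.d)) P.eps⁻¹ (expGauge P e A) k Ω *ᵥ f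
                  - gBox (B1RG242Torus.α P a k * (P.L : ℝ) ^ (k * P.d)) P.eps⁻¹ (expGauge P e A) k Finset.univ *ᵥ f) ⟨x', μ⟩
              - covD P.eps⁻¹ (cfg (expGauge P e A))
                (gBox (B1RG242Torus.α P a k * (P.L : ℝ) ^ (k * P.d)) P.eps⁻¹ (expGauge P e A) k Ω *ᵥ f
                  - gBox (B1RG242Torus.α P a k * (P.L : ℝ) ^ (k * P.d)) P.eps⁻¹ (expGauge P e A) k Finset.univ *ᵥ f) ⟨x, μ⟩‖
          ≤ c₀ * P.spacing k * Real.exp (-((D + D₀ + D₁) / (8 * (L : ℝ) ^ s * (L : ℝ) ^ k))) * M := by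
  obtain ⟨s₀, hs₀⟩ := holder_covD_gBox_sub_gBox_le d L hd hL ha e creg β hcreg hβ
  refine ⟨s₀, fun {α} hα0 hα1 s hs => ?_⟩
  obtain ⟨c₀, e₁, hc₀, he₁, hmain⟩ := hs₀ hα0 hα1 s hs
  refine ⟨c₀, e₁, hc₀, he₁, ?_⟩
  intro P hPd hPL k hk1 hkK hks hsize Ω hbig A ec hec hece hreg μ x x' hne hint hint' l hch hend hlen f M D D₀ D₁ hM hf hD hD₀ hD₁
    hsupp hsupp' hxD₀ hxD₀' hfD₁
  exact hmain P hPd hPL hk1 hkK hks hsize Ω Finset.univ hbig (fun z z' _ => by simp only [Finset.mem_univ])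
    (Finset.subset_univ Ω) A hec hece (fun z _ μ ν => hreg z μ ν) μ x x' hne hint hint' l hch hend hlen f M D D₀ D₁ hM hf hD hD₀ hD₁
    hsupp hsupp' hxD₀ hxD₀' hfD₁

end Close

/-! ## §5 The (1.9) input shape of p29's `holder19_flat_cube_level` at a regular `u = e^{ieεA}`, level-`k` units, p38's metric -/

section InputShapes

variable {P : Params}

/-- kernel: the exponent of this lineage in p31's level-`k` units. [folklore] -/
private theorem exp_units (c Ls Lk E : ℝ) (hc : c ≠ 0) (hLs : Ls ≠ 0) (hLk : Lk ≠ 0) :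
    Real.exp (-(E / (c * Ls * Lk))) = Real.exp (-(1 / (c * Ls) * (Lk⁻¹ * E))) := by
  congr 1
  field_simp

/-- kernel: `e^{−δE₊} ≤ e^{−δE}` for `δ ≥ 0`, `E ≤ E₊`. [folklore] -/
private theorem exp_le_exp_of_le {δ E E' : ℝ} (hδ : 0 ≤ δ) (hE : E ≤ E') :
    Real.exp (-(δ * E')) ≤ Real.exp (-(δ * E)) :=
  Real.exp_le_exp.2 (neg_le_neg (mul_le_mul_of_nonneg_left hE hδ))

/-- **THE (1.9) INPUT SHAPE (p29's `BIJ88LocDerivHolder230FlatTorus.holder19_flat_cube_level`) AT A REGULAR `u = e^{ieεA}`, FOR A BIG-BLOCK UNION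
`X`, AT PAIRS OF BONDS WHOSE SOURCES ARE DEEP INSIDE `X`**: for every `0 ≦ α < 1`, `∃ c₀ e₁ > 0` (after `s ≧ s₀`): for `X` a big-block union
(blocks `L^k·L^s`), `A` (2.23)-regular on `X`, `μ`, `x₁ ≠ x₂` with `{y : T(x_i,y) ≦ R₀′} ⊂ X`, a nearest-neighbour contour `Γ = (x₁, l)` to `x₂`
of length `≦ d·T(x₁,x₂)`, `f` with `‖f‖ ≦ F` supported at sup-torus distance `≧ D` from `x₁` and from `x₂`:
`(L^k/T(x₁,x₂))^α·‖U(A(Γ))·(D_uG_k(X,u)f)(x₂,μ) − (D_uG_k(X,u)f)(x₁,μ)‖ ≦ s_k·(c₀·e^{−δ₀·((L^k)⁻¹D)}·F)`, `δ₀ = 1/(4L^s)` — the flat transport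
`h(x₁)h(x₂)⁻¹` of the pure-gauge shape replaced by `U(A(Γ)) = holA e A x₁ l`.
[cite: Balaban1983RegularityDecay, Theorem p.573 (1.9)] [cite: BalabanImbrieJaffe1988, p.263 «Bounds analogous to (2.30), (2.31) hold for … Hölder derivatives»] -/
theorem input19_holder_regular_deep (d L : ℕ) (hd : 1 ≤ d) (hL : 2 ≤ L) {a : ℝ} (ha : 0 < a) (e creg β : ℝ) (hcreg : 0 ≤ creg)
    (hβ : 0 < β) :
    ∃ s₀ : ℕ, ∀ {α : ℝ}, 0 ≤ α → α < 1 → ∀ s : ℕ, s₀ ≤ s → ∃ c₀ e₁ : ℝ, 0 < c₀ ∧ 0 < e₁ ∧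
      ∀ (P : Params), P.d = d → P.L = L → ∀ {k : ℕ}, 1 ≤ k → k ≤ P.K → k + s ≤ P.m + P.K →
      3 * (L ^ k * L ^ s) ≤ P.sitesPerDir 0 →
      ∀ (X : Finset (Balaban1983to89.Site P 0)),
        (∀ z z' : Balaban1983to89.Site P 0,
          (∀ μ, (z μ).val / (L ^ k * L ^ s) = (z' μ).val / (L ^ k * L ^ s)) → (z ∈ X ↔ z' ∈ X)) →
      ∀ (A : PBond P 0 → ℝ) {ec : ℝ}, 0 < ec → ec ≤ e₁ →
      (∀ z ∈ X, ∀ μ ν : Fin P.d,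
          P.spacing k * |e| / ec * |A ⟨z.shift μ, ν⟩ - A ⟨z, ν⟩| ≤ creg * ec ^ (β - 1) / (L : ℝ) ^ k) →
      ∀ (μ : Fin P.d) (x₁ x₂ : Balaban1983to89.Site P 0), x₂ ≠ x₁ →
        (∀ y, B5Ineq137Torus.T P 0 x₁ y
          ≤ (2 * (5 * (L ^ k * L ^ s) / 8 + L ^ k) + 2 * (L ^ k * L ^ s) * (d + 1) + 1 : ℕ) → y ∈ X) →
        (∀ y, B5Ineq137Torus.T P 0 x₂ y
          ≤ (2 * (5 * (L ^ k * L ^ s) / 8 + L ^ k) + 2 * (L ^ k * L ^ s) * (d + 1) + 1 : ℕ) → y ∈ X) →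
      ∀ (l : List (Balaban1983to89.Site P 0)), IsSChain x₁ l → pathEnd x₁ l = x₂ →
        (l.length : ℝ) ≤ (d : ℝ) * B5Ineq137Torus.T P 0 x₁ x₂ →
      ∀ (f : Balaban1983to89.Site P 0 → ℂ) (F D : ℝ), (∀ y, ‖f y‖ ≤ F) →
        (∀ y, f y ≠ 0 → D ≤ B5Ineq137Torus.T P 0 x₁ y) → (∀ y, f y ≠ 0 → D ≤ B5Ineq137Torus.T P 0 x₂ y) →
        ((P.L : ℝ) ^ k / B5Ineq137Torus.T P 0 x₁ x₂) ^ α *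
            ‖holA e A x₁ l * covD P.eps⁻¹ (cfg (expGauge P e A))
                (gBox (B1RG242Torus.α P a k * (P.L : ℝ) ^ (k * P.d)) P.eps⁻¹ (expGauge P e A) k X *ᵥ f) ⟨x₂, μ⟩
              - covD P.eps⁻¹ (cfg (expGauge P e A))
                (gBox (B1RG242Torus.α P a k * (P.L : ℝ) ^ (k * P.d)) P.eps⁻¹ (expGauge P e A) k X *ᵥ f) ⟨x₁, μ⟩‖
          ≤ P.spacing k * (c₀ * Real.exp (-(1 / (4 * (L : ℝ) ^ s) * (((P.L : ℝ) ^ k)⁻¹ * D))) * F) := by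
  obtain ⟨s₀, hs₀⟩ := holder_covD_gBox_le d L hd hL ha e creg β hcreg hβ
  refine ⟨s₀, fun {α} hα0 hα1 s hs => ?_⟩
  obtain ⟨c₀, e₁, hc₀, he₁, hmain⟩ := hs₀ hα0 hα1 s hs
  refine ⟨c₀, e₁, hc₀, he₁, ?_⟩
  intro P hPd hPL k hk1 hkK hks hsize X hbig A ec hec hece hreg μ x₁ x₂ hne hint₁ hint₂ l hch hend hlen f F D hF hsD₁ hsD₂
  have hF0 : 0 ≤ F := (norm_nonneg _).trans (hF x₁)
  have hLr : (0 : ℝ) < L := by exact_mod_cast (show 0 < L by omega)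
  have hLs : (0 : ℝ) < (L : ℝ) ^ s := pow_pos hLr s
  have hLk : (0 : ℝ) < (L : ℝ) ^ k := pow_pos hLr k
  have hsk : 0 < P.spacing k := P.spacing_pos k
  have h := hmain P hPd hPL hk1 hkK hks hsize X hbig A hec hece hreg μ x₁ x₂ hne
    (fun y hy => hint₁ y (by
      rw [B3Bound323ZeroTorus.T_eq_supDist]
      exact_mod_cast hy))
    (fun y hy => hint₂ y (by
      rw [B3Bound323ZeroTorus.T_eq_supDist]
      exact_mod_cast hy))
    l hch hend (by rw [← B3Bound323ZeroTorus.T_eq_supDist]; exact hlen)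
    f F (max D 0) hF (le_max_right _ _)
    (fun z hz => by
      rw [← B3Bound323ZeroTorus.T_eq_supDist]
      exact max_le (hsD₁ z hz) (B5Ineq137Torus.T_nonneg P 0 x₁ z))
    (fun z hz => by
      rw [← B3Bound323ZeroTorus.T_eq_supDist]
      exact max_le (hsD₂ z hz) (B5Ineq137Torus.T_nonneg P 0 x₂ z))
  have hPLk : ((L : ℝ) ^ k)⁻¹ = ((P.L : ℝ) ^ k)⁻¹ := by rw [hPL]
  have hPk : (0 : ℝ) < (P.L : ℝ) ^ k := pow_pos P.cast_L_pos k
  have hquot : (((LatticeFieldCalculus.supDist x₁ x₂ : ℝ) / (L : ℝ) ^ k)⁻¹) ^ α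
      = ((P.L : ℝ) ^ k / B5Ineq137Torus.T P 0 x₁ x₂) ^ α := by
    rw [inv_div, B3Bound323ZeroTorus.T_eq_supDist, hPL]
  rw [exp_units 4 ((L : ℝ) ^ s) ((L : ℝ) ^ k) (max D 0) four_ne_zero hLs.ne' hLk.ne', hPLk, hquot] at h
  calc _ ≤ c₀ * P.spacing k * Real.exp (-(1 / (4 * (L : ℝ) ^ s) * (((P.L : ℝ) ^ k)⁻¹ * max D 0))) * F := h
    _ ≤ c₀ * P.spacing k * Real.exp (-(1 / (4 * (L : ℝ) ^ s) * (((P.L : ℝ) ^ k)⁻¹ * D))) * F :=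
        mul_le_mul_of_nonneg_right (mul_le_mul_of_nonneg_left
          (exp_le_exp_of_le (by positivity) (mul_le_mul_of_nonneg_left (le_max_left _ _) (inv_pos.2 hPk).le))
          (by positivity)) hF0
    _ = _ := by ring

end InputShapes

end

end Literature.MathematicalPhysics.QuantumFieldTheory.BalabanImbrieJaffe1984to88.BIJ85NeumannPropagatorRegularHolder
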